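import Literature.NumberTheory.Sieve.PolymathGEHCutoffBasic
import Literature.NumberTheory.Sieve.PolymathGEHCells
import Mathlib.Tactic.Ring
import Mathlib.Tactic.Linarith
import HarnessLib

/-!
# Polymath 8b, Theorem 3.15: the exact value `I(F) = 62082439864241/507343011840`

Trunk AntSieve, continuation of `PolymathGEHCutoffDef.lean` / `PolymathGEHCutoffBasic.lean`
(D. H. J. Polymath, *Variants of the Selberg sieve, and bounded intervals containing many primes*,
Res. Math. Sci. 1:12 (2014) = arXiv:1407.4897, Theorem 3.15, §7.4), toward the named fact
`Literature.NumberTheory.Sieve.weakDHL_three_two_of_GEH` (Theorem 3.2(xii)).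

§7.4 (p. 32–33) writes `I(F) = 3! I(F↾R_{xyz}) = 6 Σ_P I(F↾P)` and displays each `I(F↾P)` as an
iterated integral over one, two or three graph-structured cells; p. 34: "One may compute that
`I(F) = 62082439864241/507343011840`".  This file PROVES that identity for the tree's functional
`polymathI` (`PolymathBoundedGaps.lean`) and the cutoff `F3`:

* the fifteen cells as `GEHCutoff.GCell`s (`cellA, cellB1, cellB2, cellC1–C3, cellE, cellS1, cellS2,
  cellT1, cellT2, cellU, cellG, cellH1, cellH2`), their well-formedness (`decide`), unfolded
  membership (`Iff.rfl`), integrands, and **exact integrals** `integral_cell…` (`decide +kernel`,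
  through `GCell.integral_indicator_eq`);
* `cover_piece…` / `mem_piece…_of_mem_cell…` / `not_mem_cell…` — each open polytope `P` sits between
  the disjoint union of its open cells and the union of its closed cells (linear arithmetic), whence
  `integral_piece…` : `∫ 1_P (F↾P)² = Σ cells` exactly, and `integral_Gsq` : `I(F↾R_{xyz}) =
  62082439864241/3044058071040`;
* `polymathI_F3` : **`polymathI 3 F3 = 62082439864241/507343011840`** (`F² = Σ_σ Gsq∘σ` and
  `integral_comp_perm`), and `polymathI_F3_pos`.

## References

* [Polymath8b2014] D. H. J. Polymath, Res. Math. Sci. 1 (2014), Art. 12 = arXiv:1407.4897,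
  §7.4 (pp. 31–34), Theorem 3.15.
-/

noncomputable section

open MeasureTheory

namespace Literature.NumberTheory.Sieve

namespace GEHCutoff
/-! ### Kernel data: the pieces as `Q3` lists in the variable order of their cells -/

/-- Data: `polyA` as a `Q3` polynomial in the variable order `(u,v,w) = (x,y,z)` of its cells. [cite: Polymath8b2014, Section 7.4] -/
def qA_xyz : Q3 :=
  [[[(-66), 96, (-147), 125], [128, (-122), 104], [(-275)], [394]], [[99, (-58), 63], [(-98), 51], [41]], [[(-112), 24], [72]], [[50]]]

/-- Bridge: `qA_xyz` evaluates to the printed polynomial. [cite: Polymath8b2014, Section 7.4] -/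
theorem ev3_qA_xyz (u v w : ℝ) : ev3 u v w qA_xyz = polyA u v w := by
  simp only [qA_xyz, polyA, ev3, ev2, ev1, leval, List.foldr]
  push_cast
  ring

/-- Data: `polyB` as a `Q3` polynomial in the variable order `(u,v,w) = (z,x,y)` of its cells. [cite: Polymath8b2014, Section 7.4] -/
def qB_zxy : Q3 :=
  [[[(-41), 33, (-36), 20], [52, 15, (-24)], [(-73), 22], [25]], [[108, (-40), 26], [(-66), (-42)], [71]], [[(-294), 75], [56]], [[363]]]

/-- Bridge: `qB_zxy` evaluates to the printed polynomial. [cite: Polymath8b2014, Section 7.4] -/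
theorem ev3_qB_zxy (u v w : ℝ) : ev3 u v w qB_zxy = polyB v w u := by
  simp only [qB_zxy, polyB, ev3, ev2, ev1, leval, List.foldr]
  push_cast
  ring

/-- Data: `polyC` as a `Q3` polynomial in the variable order `(u,v,w) = (y,x,z)` of its cells. [cite: Polymath8b2014, Section 7.4] -/
def qC_yxz : Q3 :=
  [[[(-22), 63, (-140), 179], [45, (-99), 54], [(-35), 82]]]

/-- Bridge: `qC_yxz` evaluates to the printed polynomial. [cite: Polymath8b2014, Section 7.4] -/
theorem ev3_qC_yxz (u v w : ℝ) : ev3 u v w qC_yxz = polyC v u w := by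
  simp only [qC_yxz, polyC, ev3, ev2, ev1, leval, List.foldr]
  push_cast
  ring

/-- Data: `polyE` as a `Q3` polynomial in the variable order `(u,v,w) = (z,x,y)` of its cells. [cite: Polymath8b2014, Section 7.4] -/
def qE_zxy : Q3 :=
  [[[(-12)], [8]], [[32]]]

/-- Bridge: `qE_zxy` evaluates to the printed polynomial. [cite: Polymath8b2014, Section 7.4] -/
theorem ev3_qE_zxy (u v w : ℝ) : ev3 u v w qE_zxy = polyE v w u := by
  simp only [qE_zxy, polyE, ev3, ev2, ev1, leval, List.foldr]
  push_cast
  ring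

/-- Data: `polyS` as a `Q3` polynomial in the variable order `(u,v,w) = (y,z,x)` of its cells. [cite: Polymath8b2014, Section 7.4] -/
def qS_yzx : Q3 :=
  [[[(-6), 16]], [[8]]]

/-- Bridge: `qS_yzx` evaluates to the printed polynomial. [cite: Polymath8b2014, Section 7.4] -/
theorem ev3_qS_yzx (u v w : ℝ) : ev3 u v w qS_yzx = polyS w u v := by
  simp only [qS_yzx, polyS, ev3, ev2, ev1, leval, List.foldr]
  push_cast
  ring

/-- Data: `polyT` as a `Q3` polynomial in the variable order `(u,v,w) = (z,x,y)` of its cells. [cite: Polymath8b2014, Section 7.4] -/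
def qT_zxy : Q3 :=
  [[[18, (-45), 22], [(-30), 34], [12]], [[42], [(-20)]], [[(-66)]]]

/-- Bridge: `qT_zxy` evaluates to the printed polynomial. [cite: Polymath8b2014, Section 7.4] -/
theorem ev3_qT_zxy (u v w : ℝ) : ev3 u v w qT_zxy = polyT v w u := by
  simp only [qT_zxy, polyT, ev3, ev2, ev1, leval, List.foldr]
  push_cast
  ring

/-- Data: `polyU` as a `Q3` polynomial in the variable order `(u,v,w) = (x,y,z)` of its cells. [cite: Polymath8b2014, Section 7.4] -/
def qU_xyz : Q3 :=
  [[[94, (-1823), 5760, (-5128)], [54, 0, (-168)], [105]], [[0, 1422, (-2340)], [], [(-192)]], [[(-128), (-268)]], [[64]]]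

/-- Bridge: `qU_xyz` evaluates to the printed polynomial. [cite: Polymath8b2014, Section 7.4] -/
theorem ev3_qU_xyz (u v w : ℝ) : ev3 u v w qU_xyz = polyU u v w := by
  simp only [qU_xyz, polyU, ev3, ev2, ev1, leval, List.foldr]
  push_cast
  ring

/-- Data: `polyG` as a `Q3` polynomial in the variable order `(u,v,w) = (x,y,z)` of its cells. [cite: Polymath8b2014, Section 7.4] -/
def qG_xyz : Q3 :=
  [[[5274, (-19833), 18570, (-5128)], [(-18024), 44696, (-20664)], [16158, (-19056)], [(-4592)]], [[(-10704), 26860, (-12588)], [24448, (-30352)], [(-10980)]], [[7240, (-9092)], [(-8288)]], [[(-1632)]]]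

/-- Bridge: `qG_xyz` evaluates to the printed polynomial. [cite: Polymath8b2014, Section 7.4] -/
theorem ev3_qG_xyz (u v w : ℝ) : ev3 u v w qG_xyz = polyG u v w := by
  simp only [qG_xyz, polyG, ev3, ev2, ev1, leval, List.foldr]
  push_cast
  ring

/-- Data: `polyH` as a `Q3` polynomial in the variable order `(u,v,w) = (x,y,z)` of its cells. [cite: Polymath8b2014, Section 7.4] -/
def qH_xyz : Q3 :=
  [[], [[8]]]

/-- Bridge: `qH_xyz` evaluates to the printed polynomial. [cite: Polymath8b2014, Section 7.4] -/
theorem ev3_qH_xyz (u v w : ℝ) : ev3 u v w qH_xyz = polyH u v w := by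
  simp only [qH_xyz, polyH, ev3, ev2, ev1, leval, List.foldr]
  push_cast
  ring

/-! ### The fifteen graph cells of the nine non-zero pieces (pp. 32–33) -/

/-- The cell `cellA` of `I(F↾A_{xyz})` (outer `x`, middle `y`, inner `z`). [cite: Polymath8b2014, Section 7.4] -/
def cellA : GCell := ⟨0, 0, 0, (3/8), ⟨0, 0⟩, ⟨0, 1⟩, ⟨0, 1, 0⟩, ⟨(3/4), (-1), 0⟩⟩

/-- `cellA` is well formed. [folklore] -/
theorem cellA_wf : cellA.wf = true := by decide +kernel

/-- Membership in `cellA`, unfolded. [folklore] -/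
theorem mem_cellA (c : Bool) (t : Fin 3 → ℝ) : t ∈ cellA.set c ↔
    (rel c ((0 : ℚ) : ℝ) (t 0) ∧ rel c (t 0) ((3/8 : ℚ) : ℝ)) ∧
    (rel c (((0 : ℚ) : ℝ) + ((0 : ℚ) : ℝ) * t 0) (t 1) ∧ rel c (t 1) (((0 : ℚ) : ℝ) + ((1 : ℚ) : ℝ) * t 0)) ∧
    (rel c (((0 : ℚ) : ℝ) + ((1 : ℚ) : ℝ) * t 0 + ((0 : ℚ) : ℝ) * t 1) (t 2) ∧ rel c (t 2) (((3/4 : ℚ) : ℝ) + ((-1 : ℚ) : ℝ) * t 0 + ((0 : ℚ) : ℝ) * t 1)) := Iff.rfl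

/-- The integrand of `cellA` is `(F↾A)²`. [cite: Polymath8b2014, Section 7.4] -/
theorem integrand_cellA (t : Fin 3 → ℝ) : cellA.integrand (ops3.mul qA_xyz qA_xyz) t = polyA (t 0) (t 1) (t 2) ^ 2 := by
  show ev3 (t 0) (t 1) (t 2) (ops3.mul qA_xyz qA_xyz) = _
  rw [(lawful3 _ _ _).mul, ev3_qA_xyz]
  ring

/-- **`∫_{cellA} (F↾A)² = 510146607951/37580963840`** (exact, kernel-evaluated). [cite: Polymath8b2014, Section 7.4] -/
theorem integral_cellA : cellA.integral (ops3.mul qA_xyz qA_xyz) = 510146607951 / 37580963840 := by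
  decide +kernel

/-- The cell `cellB1` of `I(F↾B_{xyz})` (outer `z`, middle `x`, inner `y`). [cite: Polymath8b2014, Section 7.4] -/
def cellB1 : GCell := ⟨2, 0, (3/8), (5/8), ⟨(3/4), (-1)⟩, ⟨0, 1⟩, ⟨0, 0, 0⟩, ⟨(3/4), (-1), 0⟩⟩

/-- `cellB1` is well formed. [folklore] -/
theorem cellB1_wf : cellB1.wf = true := by decide +kernel

/-- Membership in `cellB1`, unfolded. [folklore] -/
theorem mem_cellB1 (c : Bool) (t : Fin 3 → ℝ) : t ∈ cellB1.set c ↔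
    (rel c ((3/8 : ℚ) : ℝ) (t 2) ∧ rel c (t 2) ((5/8 : ℚ) : ℝ)) ∧
    (rel c (((3/4 : ℚ) : ℝ) + ((-1 : ℚ) : ℝ) * t 2) (t 0) ∧ rel c (t 0) (((0 : ℚ) : ℝ) + ((1 : ℚ) : ℝ) * t 2)) ∧
    (rel c (((0 : ℚ) : ℝ) + ((0 : ℚ) : ℝ) * t 2 + ((0 : ℚ) : ℝ) * t 0) (t 1) ∧ rel c (t 1) (((3/4 : ℚ) : ℝ) + ((-1 : ℚ) : ℝ) * t 2 + ((0 : ℚ) : ℝ) * t 0)) := Iff.rfl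

/-- The integrand of `cellB1` is `(F↾B)²`. [cite: Polymath8b2014, Section 7.4] -/
theorem integrand_cellB1 (t : Fin 3 → ℝ) : cellB1.integrand (ops3.mul qB_zxy qB_zxy) t = polyB (t 0) (t 1) (t 2) ^ 2 := by
  show ev3 (t 2) (t 0) (t 1) (ops3.mul qB_zxy qB_zxy) = _
  rw [(lawful3 _ _ _).mul, ev3_qB_zxy]
  ring

/-- **`∫_{cellB1} (F↾B)² = 45659974501/19025362944`** (exact, kernel-evaluated). [cite: Polymath8b2014, Section 7.4] -/
theorem integral_cellB1 : cellB1.integral (ops3.mul qB_zxy qB_zxy) = 45659974501 / 19025362944 := by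
  decide +kernel

/-- The cell `cellB2` of `I(F↾B_{xyz})` (outer `z`, middle `x`, inner `y`). [cite: Polymath8b2014, Section 7.4] -/
def cellB2 : GCell := ⟨2, 0, (5/8), (3/4), ⟨(3/4), (-1)⟩, ⟨(5/4), (-1)⟩, ⟨0, 0, 0⟩, ⟨(3/4), (-1), 0⟩⟩

/-- `cellB2` is well formed. [folklore] -/
theorem cellB2_wf : cellB2.wf = true := by decide +kernel

/-- Membership in `cellB2`, unfolded. [folklore] -/
theorem mem_cellB2 (c : Bool) (t : Fin 3 → ℝ) : t ∈ cellB2.set c ↔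
    (rel c ((5/8 : ℚ) : ℝ) (t 2) ∧ rel c (t 2) ((3/4 : ℚ) : ℝ)) ∧
    (rel c (((3/4 : ℚ) : ℝ) + ((-1 : ℚ) : ℝ) * t 2) (t 0) ∧ rel c (t 0) (((5/4 : ℚ) : ℝ) + ((-1 : ℚ) : ℝ) * t 2)) ∧
    (rel c (((0 : ℚ) : ℝ) + ((0 : ℚ) : ℝ) * t 2 + ((0 : ℚ) : ℝ) * t 0) (t 1) ∧ rel c (t 1) (((3/4 : ℚ) : ℝ) + ((-1 : ℚ) : ℝ) * t 2 + ((0 : ℚ) : ℝ) * t 0)) := Iff.rfl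

/-- The integrand of `cellB2` is `(F↾B)²`. [cite: Polymath8b2014, Section 7.4] -/
theorem integrand_cellB2 (t : Fin 3 → ℝ) : cellB2.integrand (ops3.mul qB_zxy qB_zxy) t = polyB (t 0) (t 1) (t 2) ^ 2 := by
  show ev3 (t 2) (t 0) (t 1) (ops3.mul qB_zxy qB_zxy) = _
  rw [(lawful3 _ _ _).mul, ev3_qB_zxy]
  ring

/-- **`∫_{cellB2} (F↾B)² = 64876195087/63417876480`** (exact, kernel-evaluated). [cite: Polymath8b2014, Section 7.4] -/
theorem integral_cellB2 : cellB2.integral (ops3.mul qB_zxy qB_zxy) = 64876195087 / 63417876480 := by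
  decide +kernel

/-- The cell `cellC1` of `I(F↾C_{xyz})` (outer `y`, middle `x`, inner `z`). [cite: Polymath8b2014, Section 7.4] -/
def cellC1 : GCell := ⟨1, 0, 0, (1/8), ⟨0, 1⟩, ⟨(1/2), 1⟩, ⟨(3/4), (-1), 0⟩, ⟨(5/4), 0, (-1)⟩⟩

/-- `cellC1` is well formed. [folklore] -/
theorem cellC1_wf : cellC1.wf = true := by decide +kernel

/-- Membership in `cellC1`, unfolded. [folklore] -/
theorem mem_cellC1 (c : Bool) (t : Fin 3 → ℝ) : t ∈ cellC1.set c ↔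
    (rel c ((0 : ℚ) : ℝ) (t 1) ∧ rel c (t 1) ((1/8 : ℚ) : ℝ)) ∧
    (rel c (((0 : ℚ) : ℝ) + ((1 : ℚ) : ℝ) * t 1) (t 0) ∧ rel c (t 0) (((1/2 : ℚ) : ℝ) + ((1 : ℚ) : ℝ) * t 1)) ∧
    (rel c (((3/4 : ℚ) : ℝ) + ((-1 : ℚ) : ℝ) * t 1 + ((0 : ℚ) : ℝ) * t 0) (t 2) ∧ rel c (t 2) (((5/4 : ℚ) : ℝ) + ((0 : ℚ) : ℝ) * t 1 + ((-1 : ℚ) : ℝ) * t 0)) := Iff.rfl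

/-- The integrand of `cellC1` is `(F↾C)²`. [cite: Polymath8b2014, Section 7.4] -/
theorem integrand_cellC1 (t : Fin 3 → ℝ) : cellC1.integrand (ops3.mul qC_yxz qC_yxz) t = polyC (t 0) (t 1) (t 2) ^ 2 := by
  show ev3 (t 1) (t 0) (t 2) (ops3.mul qC_yxz qC_yxz) = _
  rw [(lawful3 _ _ _).mul, ev3_qC_yxz]
  ring

/-- **`∫_{cellC1} (F↾C)² = 1801805723/754974720`** (exact, kernel-evaluated). [cite: Polymath8b2014, Section 7.4] -/
theorem integral_cellC1 : cellC1.integral (ops3.mul qC_yxz qC_yxz) = 1801805723 / 754974720 := by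
  decide +kernel

/-- The cell `cellC2` of `I(F↾C_{xyz})` (outer `y`, middle `x`, inner `z`). [cite: Polymath8b2014, Section 7.4] -/
def cellC2 : GCell := ⟨1, 0, (1/8), (1/4), ⟨0, 1⟩, ⟨(3/4), (-1)⟩, ⟨(3/4), (-1), 0⟩, ⟨(5/4), 0, (-1)⟩⟩

/-- `cellC2` is well formed. [folklore] -/
theorem cellC2_wf : cellC2.wf = true := by decide +kernel

/-- Membership in `cellC2`, unfolded. [folklore] -/
theorem mem_cellC2 (c : Bool) (t : Fin 3 → ℝ) : t ∈ cellC2.set c ↔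
    (rel c ((1/8 : ℚ) : ℝ) (t 1) ∧ rel c (t 1) ((1/4 : ℚ) : ℝ)) ∧
    (rel c (((0 : ℚ) : ℝ) + ((1 : ℚ) : ℝ) * t 1) (t 0) ∧ rel c (t 0) (((3/4 : ℚ) : ℝ) + ((-1 : ℚ) : ℝ) * t 1)) ∧
    (rel c (((3/4 : ℚ) : ℝ) + ((-1 : ℚ) : ℝ) * t 1 + ((0 : ℚ) : ℝ) * t 0) (t 2) ∧ rel c (t 2) (((5/4 : ℚ) : ℝ) + ((0 : ℚ) : ℝ) * t 1 + ((-1 : ℚ) : ℝ) * t 0)) := Iff.rfl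

/-- The integrand of `cellC2` is `(F↾C)²`. [cite: Polymath8b2014, Section 7.4] -/
theorem integrand_cellC2 (t : Fin 3 → ℝ) : cellC2.integrand (ops3.mul qC_yxz qC_yxz) t = polyC (t 0) (t 1) (t 2) ^ 2 := by
  show ev3 (t 1) (t 0) (t 2) (ops3.mul qC_yxz qC_yxz) = _
  rw [(lawful3 _ _ _).mul, ev3_qC_yxz]
  ring

/-- **`∫_{cellC2} (F↾C)² = 188256097591/253671505920`** (exact, kernel-evaluated). [cite: Polymath8b2014, Section 7.4] -/
theorem integral_cellC2 : cellC2.integral (ops3.mul qC_yxz qC_yxz) = 188256097591 / 253671505920 := by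
  decide +kernel

/-- The cell `cellC3` of `I(F↾C_{xyz})` (outer `y`, middle `x`, inner `z`). [cite: Polymath8b2014, Section 7.4] -/
def cellC3 : GCell := ⟨1, 0, (1/4), (3/8), ⟨0, 1⟩, ⟨(3/4), (-1)⟩, ⟨(3/4), (-1), 0⟩, ⟨(3/2), (-1), (-1)⟩⟩

/-- `cellC3` is well formed. [folklore] -/
theorem cellC3_wf : cellC3.wf = true := by decide +kernel

/-- Membership in `cellC3`, unfolded. [folklore] -/
theorem mem_cellC3 (c : Bool) (t : Fin 3 → ℝ) : t ∈ cellC3.set c ↔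
    (rel c ((1/4 : ℚ) : ℝ) (t 1) ∧ rel c (t 1) ((3/8 : ℚ) : ℝ)) ∧
    (rel c (((0 : ℚ) : ℝ) + ((1 : ℚ) : ℝ) * t 1) (t 0) ∧ rel c (t 0) (((3/4 : ℚ) : ℝ) + ((-1 : ℚ) : ℝ) * t 1)) ∧
    (rel c (((3/4 : ℚ) : ℝ) + ((-1 : ℚ) : ℝ) * t 1 + ((0 : ℚ) : ℝ) * t 0) (t 2) ∧ rel c (t 2) (((3/2 : ℚ) : ℝ) + ((-1 : ℚ) : ℝ) * t 1 + ((-1 : ℚ) : ℝ) * t 0)) := Iff.rfl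

/-- The integrand of `cellC3` is `(F↾C)²`. [cite: Polymath8b2014, Section 7.4] -/
theorem integrand_cellC3 (t : Fin 3 → ℝ) : cellC3.integrand (ops3.mul qC_yxz qC_yxz) t = polyC (t 0) (t 1) (t 2) ^ 2 := by
  show ev3 (t 1) (t 0) (t 2) (ops3.mul qC_yxz qC_yxz) = _
  rw [(lawful3 _ _ _).mul, ev3_qC_yxz]
  ring

/-- **`∫_{cellC3} (F↾C)² = 8364218453/56371445760`** (exact, kernel-evaluated). [cite: Polymath8b2014, Section 7.4] -/
theorem integral_cellC3 : cellC3.integral (ops3.mul qC_yxz qC_yxz) = 8364218453 / 56371445760 := by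
  decide +kernel

/-- The cell `cellE` of `I(F↾E_{xyz})` (outer `z`, middle `x`, inner `y`). [cite: Polymath8b2014, Section 7.4] -/
def cellE : GCell := ⟨2, 0, (5/8), (3/4), ⟨(5/4), (-1)⟩, ⟨0, 1⟩, ⟨0, 0, 0⟩, ⟨(3/4), (-1), 0⟩⟩

/-- `cellE` is well formed. [folklore] -/
theorem cellE_wf : cellE.wf = true := by decide +kernel

/-- Membership in `cellE`, unfolded. [folklore] -/
theorem mem_cellE (c : Bool) (t : Fin 3 → ℝ) : t ∈ cellE.set c ↔
    (rel c ((5/8 : ℚ) : ℝ) (t 2) ∧ rel c (t 2) ((3/4 : ℚ) : ℝ)) ∧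
    (rel c (((5/4 : ℚ) : ℝ) + ((-1 : ℚ) : ℝ) * t 2) (t 0) ∧ rel c (t 0) (((0 : ℚ) : ℝ) + ((1 : ℚ) : ℝ) * t 2)) ∧
    (rel c (((0 : ℚ) : ℝ) + ((0 : ℚ) : ℝ) * t 2 + ((0 : ℚ) : ℝ) * t 0) (t 1) ∧ rel c (t 1) (((3/4 : ℚ) : ℝ) + ((-1 : ℚ) : ℝ) * t 2 + ((0 : ℚ) : ℝ) * t 0)) := Iff.rfl

/-- The integrand of `cellE` is `(F↾E)²`. [cite: Polymath8b2014, Section 7.4] -/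
theorem integrand_cellE (t : Fin 3 → ℝ) : cellE.integrand (ops3.mul qE_zxy qE_zxy) t = polyE (t 0) (t 1) (t 2) ^ 2 := by
  show ev3 (t 2) (t 0) (t 1) (ops3.mul qE_zxy qE_zxy) = _
  rw [(lawful3 _ _ _).mul, ev3_qE_zxy]
  ring

/-- **`∫_{cellE} (F↾E)² = 367/15360`** (exact, kernel-evaluated). [cite: Polymath8b2014, Section 7.4] -/
theorem integral_cellE : cellE.integral (ops3.mul qE_zxy qE_zxy) = 367 / 15360 := by
  decide +kernel

/-- The cell `cellS1` of `I(F↾S_{xyz})` (outer `y`, middle `z`, inner `x`). [cite: Polymath8b2014, Section 7.4] -/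
def cellS1 : GCell := ⟨1, 1, 0, (1/8), ⟨(3/4), (-1)⟩, ⟨(3/4), 0⟩, ⟨(5/4), 0, (-1)⟩, ⟨(3/4), (-1), 0⟩⟩

/-- `cellS1` is well formed. [folklore] -/
theorem cellS1_wf : cellS1.wf = true := by decide +kernel

/-- Membership in `cellS1`, unfolded. [folklore] -/
theorem mem_cellS1 (c : Bool) (t : Fin 3 → ℝ) : t ∈ cellS1.set c ↔
    (rel c ((0 : ℚ) : ℝ) (t 1) ∧ rel c (t 1) ((1/8 : ℚ) : ℝ)) ∧
    (rel c (((3/4 : ℚ) : ℝ) + ((-1 : ℚ) : ℝ) * t 1) (t 2) ∧ rel c (t 2) (((3/4 : ℚ) : ℝ) + ((0 : ℚ) : ℝ) * t 1)) ∧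
    (rel c (((5/4 : ℚ) : ℝ) + ((0 : ℚ) : ℝ) * t 1 + ((-1 : ℚ) : ℝ) * t 2) (t 0) ∧ rel c (t 0) (((3/4 : ℚ) : ℝ) + ((-1 : ℚ) : ℝ) * t 1 + ((0 : ℚ) : ℝ) * t 2)) := Iff.rfl

/-- The integrand of `cellS1` is `(F↾S)²`. [cite: Polymath8b2014, Section 7.4] -/
theorem integrand_cellS1 (t : Fin 3 → ℝ) : cellS1.integrand (ops3.mul qS_yzx qS_yzx) t = polyS (t 0) (t 1) (t 2) ^ 2 := by
  show ev3 (t 1) (t 2) (t 0) (ops3.mul qS_yzx qS_yzx) = _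
  rw [(lawful3 _ _ _).mul, ev3_qS_yzx]
  ring

/-- **`∫_{cellS1} (F↾S)² = 3/10240`** (exact, kernel-evaluated). [cite: Polymath8b2014, Section 7.4] -/
theorem integral_cellS1 : cellS1.integral (ops3.mul qS_yzx qS_yzx) = 3 / 10240 := by
  decide +kernel

/-- The cell `cellS2` of `I(F↾S_{xyz})` (outer `y`, middle `z`, inner `x`). [cite: Polymath8b2014, Section 7.4] -/
def cellS2 : GCell := ⟨1, 1, (1/8), (1/4), ⟨(1/2), 1⟩, ⟨(3/4), 0⟩, ⟨(5/4), 0, (-1)⟩, ⟨(3/4), (-1), 0⟩⟩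

/-- `cellS2` is well formed. [folklore] -/
theorem cellS2_wf : cellS2.wf = true := by decide +kernel

/-- Membership in `cellS2`, unfolded. [folklore] -/
theorem mem_cellS2 (c : Bool) (t : Fin 3 → ℝ) : t ∈ cellS2.set c ↔
    (rel c ((1/8 : ℚ) : ℝ) (t 1) ∧ rel c (t 1) ((1/4 : ℚ) : ℝ)) ∧
    (rel c (((1/2 : ℚ) : ℝ) + ((1 : ℚ) : ℝ) * t 1) (t 2) ∧ rel c (t 2) (((3/4 : ℚ) : ℝ) + ((0 : ℚ) : ℝ) * t 1)) ∧
    (rel c (((5/4 : ℚ) : ℝ) + ((0 : ℚ) : ℝ) * t 1 + ((-1 : ℚ) : ℝ) * t 2) (t 0) ∧ rel c (t 0) (((3/4 : ℚ) : ℝ) + ((-1 : ℚ) : ℝ) * t 1 + ((0 : ℚ) : ℝ) * t 2)) := Iff.rfl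

/-- The integrand of `cellS2` is `(F↾S)²`. [cite: Polymath8b2014, Section 7.4] -/
theorem integrand_cellS2 (t : Fin 3 → ℝ) : cellS2.integrand (ops3.mul qS_yzx qS_yzx) t = polyS (t 0) (t 1) (t 2) ^ 2 := by
  show ev3 (t 1) (t 2) (t 0) (ops3.mul qS_yzx qS_yzx) = _
  rw [(lawful3 _ _ _).mul, ev3_qS_yzx]
  ring

/-- **`∫_{cellS2} (F↾S)² = 11/30720`** (exact, kernel-evaluated). [cite: Polymath8b2014, Section 7.4] -/
theorem integral_cellS2 : cellS2.integral (ops3.mul qS_yzx qS_yzx) = 11 / 30720 := by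
  decide +kernel

/-- The cell `cellT1` of `I(F↾T_{xyz})` (outer `z`, middle `x`, inner `y`). [cite: Polymath8b2014, Section 7.4] -/
def cellT1 : GCell := ⟨2, 0, (3/4), 1, ⟨(5/4), (-1)⟩, ⟨(3/2), (-1)⟩, ⟨0, 0, 0⟩, ⟨(3/2), (-1), (-1)⟩⟩

/-- `cellT1` is well formed. [folklore] -/
theorem cellT1_wf : cellT1.wf = true := by decide +kernel

/-- Membership in `cellT1`, unfolded. [folklore] -/
theorem mem_cellT1 (c : Bool) (t : Fin 3 → ℝ) : t ∈ cellT1.set c ↔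
    (rel c ((3/4 : ℚ) : ℝ) (t 2) ∧ rel c (t 2) ((1 : ℚ) : ℝ)) ∧
    (rel c (((5/4 : ℚ) : ℝ) + ((-1 : ℚ) : ℝ) * t 2) (t 0) ∧ rel c (t 0) (((3/2 : ℚ) : ℝ) + ((-1 : ℚ) : ℝ) * t 2)) ∧
    (rel c (((0 : ℚ) : ℝ) + ((0 : ℚ) : ℝ) * t 2 + ((0 : ℚ) : ℝ) * t 0) (t 1) ∧ rel c (t 1) (((3/2 : ℚ) : ℝ) + ((-1 : ℚ) : ℝ) * t 2 + ((-1 : ℚ) : ℝ) * t 0)) := Iff.rfl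

/-- The integrand of `cellT1` is `(F↾T)²`. [cite: Polymath8b2014, Section 7.4] -/
theorem integrand_cellT1 (t : Fin 3 → ℝ) : cellT1.integrand (ops3.mul qT_zxy qT_zxy) t = polyT (t 0) (t 1) (t 2) ^ 2 := by
  show ev3 (t 2) (t 0) (t 1) (ops3.mul qT_zxy qT_zxy) = _
  rw [(lawful3 _ _ _).mul, ev3_qT_zxy]
  ring

/-- **`∫_{cellT1} (F↾T)² = 2149/245760`** (exact, kernel-evaluated). [cite: Polymath8b2014, Section 7.4] -/
theorem integral_cellT1 : cellT1.integral (ops3.mul qT_zxy qT_zxy) = 2149 / 245760 := by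
  decide +kernel

/-- The cell `cellT2` of `I(F↾T_{xyz})` (outer `z`, middle `x`, inner `y`). [cite: Polymath8b2014, Section 7.4] -/
def cellT2 : GCell := ⟨2, 0, 1, (5/4), ⟨(1/4), 0⟩, ⟨(3/2), (-1)⟩, ⟨0, 0, 0⟩, ⟨(3/2), (-1), (-1)⟩⟩

/-- `cellT2` is well formed. [folklore] -/
theorem cellT2_wf : cellT2.wf = true := by decide +kernel

/-- Membership in `cellT2`, unfolded. [folklore] -/
theorem mem_cellT2 (c : Bool) (t : Fin 3 → ℝ) : t ∈ cellT2.set c ↔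
    (rel c ((1 : ℚ) : ℝ) (t 2) ∧ rel c (t 2) ((5/4 : ℚ) : ℝ)) ∧
    (rel c (((1/4 : ℚ) : ℝ) + ((0 : ℚ) : ℝ) * t 2) (t 0) ∧ rel c (t 0) (((3/2 : ℚ) : ℝ) + ((-1 : ℚ) : ℝ) * t 2)) ∧
    (rel c (((0 : ℚ) : ℝ) + ((0 : ℚ) : ℝ) * t 2 + ((0 : ℚ) : ℝ) * t 0) (t 1) ∧ rel c (t 1) (((3/2 : ℚ) : ℝ) + ((-1 : ℚ) : ℝ) * t 2 + ((-1 : ℚ) : ℝ) * t 0)) := Iff.rfl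

/-- The integrand of `cellT2` is `(F↾T)²`. [cite: Polymath8b2014, Section 7.4] -/
theorem integrand_cellT2 (t : Fin 3 → ℝ) : cellT2.integrand (ops3.mul qT_zxy qT_zxy) t = polyT (t 0) (t 1) (t 2) ^ 2 := by
  show ev3 (t 2) (t 0) (t 1) (ops3.mul qT_zxy qT_zxy) = _
  rw [(lawful3 _ _ _).mul, ev3_qT_zxy]
  ring

/-- **`∫_{cellT2} (F↾T)² = 13619/5160960`** (exact, kernel-evaluated). [cite: Polymath8b2014, Section 7.4] -/
theorem integral_cellT2 : cellT2.integral (ops3.mul qT_zxy qT_zxy) = 13619 / 5160960 := by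
  decide +kernel

/-- The cell `cellU` of `I(F↾U_{xyz})` (outer `x`, middle `y`, inner `z`). [cite: Polymath8b2014, Section 7.4] -/
def cellU : GCell := ⟨0, 0, 0, (1/4), ⟨0, 0⟩, ⟨0, 1⟩, ⟨(5/4), (-1), 0⟩, ⟨(5/4), 0, (-1)⟩⟩

/-- `cellU` is well formed. [folklore] -/
theorem cellU_wf : cellU.wf = true := by decide +kernel

/-- Membership in `cellU`, unfolded. [folklore] -/
theorem mem_cellU (c : Bool) (t : Fin 3 → ℝ) : t ∈ cellU.set c ↔
    (rel c ((0 : ℚ) : ℝ) (t 0) ∧ rel c (t 0) ((1/4 : ℚ) : ℝ)) ∧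
    (rel c (((0 : ℚ) : ℝ) + ((0 : ℚ) : ℝ) * t 0) (t 1) ∧ rel c (t 1) (((0 : ℚ) : ℝ) + ((1 : ℚ) : ℝ) * t 0)) ∧
    (rel c (((5/4 : ℚ) : ℝ) + ((-1 : ℚ) : ℝ) * t 0 + ((0 : ℚ) : ℝ) * t 1) (t 2) ∧ rel c (t 2) (((5/4 : ℚ) : ℝ) + ((0 : ℚ) : ℝ) * t 0 + ((-1 : ℚ) : ℝ) * t 1)) := Iff.rfl

/-- The integrand of `cellU` is `(F↾U)²`. [cite: Polymath8b2014, Section 7.4] -/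
theorem integrand_cellU (t : Fin 3 → ℝ) : cellU.integrand (ops3.mul qU_xyz qU_xyz) t = polyU (t 0) (t 1) (t 2) ^ 2 := by
  show ev3 (t 0) (t 1) (t 2) (ops3.mul qU_xyz qU_xyz) = _
  rw [(lawful3 _ _ _).mul, ev3_qU_xyz]
  ring

/-- **`∫_{cellU} (F↾U)² = 8574409/247726080`** (exact, kernel-evaluated). [cite: Polymath8b2014, Section 7.4] -/
theorem integral_cellU : cellU.integral (ops3.mul qU_xyz qU_xyz) = 8574409 / 247726080 := by
  decide +kernel

/-- The cell `cellG` of `I(F↾G_{xyz})` (outer `x`, middle `y`, inner `z`). [cite: Polymath8b2014, Section 7.4] -/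
def cellG : GCell := ⟨0, 0, 0, (1/4), ⟨0, 0⟩, ⟨0, 1⟩, ⟨(5/4), 0, (-1)⟩, ⟨(3/2), (-1), (-1)⟩⟩

/-- `cellG` is well formed. [folklore] -/
theorem cellG_wf : cellG.wf = true := by decide +kernel

/-- Membership in `cellG`, unfolded. [folklore] -/
theorem mem_cellG (c : Bool) (t : Fin 3 → ℝ) : t ∈ cellG.set c ↔
    (rel c ((0 : ℚ) : ℝ) (t 0) ∧ rel c (t 0) ((1/4 : ℚ) : ℝ)) ∧
    (rel c (((0 : ℚ) : ℝ) + ((0 : ℚ) : ℝ) * t 0) (t 1) ∧ rel c (t 1) (((0 : ℚ) : ℝ) + ((1 : ℚ) : ℝ) * t 0)) ∧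
    (rel c (((5/4 : ℚ) : ℝ) + ((0 : ℚ) : ℝ) * t 0 + ((-1 : ℚ) : ℝ) * t 1) (t 2) ∧ rel c (t 2) (((3/2 : ℚ) : ℝ) + ((-1 : ℚ) : ℝ) * t 0 + ((-1 : ℚ) : ℝ) * t 1)) := Iff.rfl

/-- The integrand of `cellG` is `(F↾G)²`. [cite: Polymath8b2014, Section 7.4] -/
theorem integrand_cellG (t : Fin 3 → ℝ) : cellG.integrand (ops3.mul qG_xyz qG_xyz) t = polyG (t 0) (t 1) (t 2) ^ 2 := by
  show ev3 (t 0) (t 1) (t 2) (ops3.mul qG_xyz qG_xyz) = _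
  rw [(lawful3 _ _ _).mul, ev3_qG_xyz]
  ring

/-- **`∫_{cellG} (F↾G)² = 4419599/148635648`** (exact, kernel-evaluated). [cite: Polymath8b2014, Section 7.4] -/
theorem integral_cellG : cellG.integral (ops3.mul qG_xyz qG_xyz) = 4419599 / 148635648 := by
  decide +kernel

/-- The cell `cellH1` of `I(F↾H_{xyz})` (outer `x`, middle `y`, inner `z`). [cite: Polymath8b2014, Section 7.4] -/
def cellH1 : GCell := ⟨0, 0, (5/8), (3/4), ⟨(3/4), (-1)⟩, ⟨(3/2), (-2)⟩, ⟨0, 1, 0⟩, ⟨(3/2), (-1), (-1)⟩⟩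

/-- `cellH1` is well formed. [folklore] -/
theorem cellH1_wf : cellH1.wf = true := by decide +kernel

/-- Membership in `cellH1`, unfolded. [folklore] -/
theorem mem_cellH1 (c : Bool) (t : Fin 3 → ℝ) : t ∈ cellH1.set c ↔
    (rel c ((5/8 : ℚ) : ℝ) (t 0) ∧ rel c (t 0) ((3/4 : ℚ) : ℝ)) ∧
    (rel c (((3/4 : ℚ) : ℝ) + ((-1 : ℚ) : ℝ) * t 0) (t 1) ∧ rel c (t 1) (((3/2 : ℚ) : ℝ) + ((-2 : ℚ) : ℝ) * t 0)) ∧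
    (rel c (((0 : ℚ) : ℝ) + ((1 : ℚ) : ℝ) * t 0 + ((0 : ℚ) : ℝ) * t 1) (t 2) ∧ rel c (t 2) (((3/2 : ℚ) : ℝ) + ((-1 : ℚ) : ℝ) * t 0 + ((-1 : ℚ) : ℝ) * t 1)) := Iff.rfl

/-- The integrand of `cellH1` is `(F↾H)²`. [cite: Polymath8b2014, Section 7.4] -/
theorem integrand_cellH1 (t : Fin 3 → ℝ) : cellH1.integrand (ops3.mul qH_xyz qH_xyz) t = polyH (t 0) (t 1) (t 2) ^ 2 := by
  show ev3 (t 0) (t 1) (t 2) (ops3.mul qH_xyz qH_xyz) = _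
  rw [(lawful3 _ _ _).mul, ev3_qH_xyz]
  ring

/-- **`∫_{cellH1} (F↾H)² = 101/10240`** (exact, kernel-evaluated). [cite: Polymath8b2014, Section 7.4] -/
theorem integral_cellH1 : cellH1.integral (ops3.mul qH_xyz qH_xyz) = 101 / 10240 := by
  decide +kernel

/-- The cell `cellH2` of `I(F↾H_{xyz})` (outer `x`, middle `y`, inner `z`). [cite: Polymath8b2014, Section 7.4] -/
def cellH2 : GCell := ⟨0, 0, (1/2), (5/8), ⟨(3/4), (-1)⟩, ⟨(1/4), 0⟩, ⟨(5/4), (-1), 0⟩, ⟨(3/2), (-1), (-1)⟩⟩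

/-- `cellH2` is well formed. [folklore] -/
theorem cellH2_wf : cellH2.wf = true := by decide +kernel

/-- Membership in `cellH2`, unfolded. [folklore] -/
theorem mem_cellH2 (c : Bool) (t : Fin 3 → ℝ) : t ∈ cellH2.set c ↔
    (rel c ((1/2 : ℚ) : ℝ) (t 0) ∧ rel c (t 0) ((5/8 : ℚ) : ℝ)) ∧
    (rel c (((3/4 : ℚ) : ℝ) + ((-1 : ℚ) : ℝ) * t 0) (t 1) ∧ rel c (t 1) (((1/4 : ℚ) : ℝ) + ((0 : ℚ) : ℝ) * t 0)) ∧
    (rel c (((5/4 : ℚ) : ℝ) + ((-1 : ℚ) : ℝ) * t 0 + ((0 : ℚ) : ℝ) * t 1) (t 2) ∧ rel c (t 2) (((3/2 : ℚ) : ℝ) + ((-1 : ℚ) : ℝ) * t 0 + ((-1 : ℚ) : ℝ) * t 1)) := Iff.rfl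

/-- The integrand of `cellH2` is `(F↾H)²`. [cite: Polymath8b2014, Section 7.4] -/
theorem integrand_cellH2 (t : Fin 3 → ℝ) : cellH2.integrand (ops3.mul qH_xyz qH_xyz) t = polyH (t 0) (t 1) (t 2) ^ 2 := by
  show ev3 (t 0) (t 1) (t 2) (ops3.mul qH_xyz qH_xyz) = _
  rw [(lawful3 _ _ _).mul, ev3_qH_xyz]
  ring

/-- **`∫_{cellH2} (F↾H)² = 101/10240`** (exact, kernel-evaluated). [cite: Polymath8b2014, Section 7.4] -/
theorem integral_cellH2 : cellH2.integral (ops3.mul qH_xyz qH_xyz) = 101 / 10240 := by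
  decide +kernel

/-! ### Covering, containment and disjointness -/

/-- The open cell `cellA` lies in `A_{xyz}`. [folklore] -/
theorem mem_pieceA_of_mem_cellA {t : Fin 3 → ℝ} (h : t ∈ cellA.set false) : t ∈ pieceA := by
  rw [mem_cellA] at h
  simp only [rel, Bool.false_eq_true, ↓reduceIte] at h
  push_cast at h
  obtain ⟨⟨h1, h2⟩, ⟨h3, h4⟩, ⟨h5, h6⟩⟩ := h
  refine ⟨⟨?_, ?_, ?_, ?_⟩, ?_⟩ <;> linarith

/-- **Cover**: `A_{xyz}` is contained in the union of its closed cells (the displayed iterated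
integral for `I(F↾A_{xyz})`, p. 32–33). [cite: Polymath8b2014, Section 7.4] -/
theorem cover_pieceA {t : Fin 3 → ℝ} (h : t ∈ pieceA) : t ∈ cellA.set true := by
  obtain ⟨⟨hb0, hb1, hb2, hb3⟩, he0⟩ := h
  rw [mem_cellA]
  simp only [rel, ↓reduceIte]
  push_cast
  refine ⟨⟨?_, ?_⟩, ⟨?_, ?_⟩, ⟨?_, ?_⟩⟩ <;> linarith

/-- The open cell `cellB1` lies in `B_{xyz}`. [folklore] -/
theorem mem_pieceB_of_mem_cellB1 {t : Fin 3 → ℝ} (h : t ∈ cellB1.set false) : t ∈ pieceB := by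
  rw [mem_cellB1] at h
  simp only [rel, Bool.false_eq_true, ↓reduceIte] at h
  push_cast at h
  obtain ⟨⟨h1, h2⟩, ⟨h3, h4⟩, ⟨h5, h6⟩⟩ := h
  refine ⟨⟨?_, ?_, ?_, ?_⟩, ⟨?_, ?_, ?_⟩⟩ <;> linarith

/-- The open cell `cellB2` lies in `B_{xyz}`. [folklore] -/
theorem mem_pieceB_of_mem_cellB2 {t : Fin 3 → ℝ} (h : t ∈ cellB2.set false) : t ∈ pieceB := by
  rw [mem_cellB2] at h
  simp only [rel, Bool.false_eq_true, ↓reduceIte] at h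
  push_cast at h
  obtain ⟨⟨h1, h2⟩, ⟨h3, h4⟩, ⟨h5, h6⟩⟩ := h
  refine ⟨⟨?_, ?_, ?_, ?_⟩, ⟨?_, ?_, ?_⟩⟩ <;> linarith

/-- The open cells `cellB1`, `cellB2` are disjoint. [folklore] -/
theorem not_mem_cellB2_of_mem_cellB1 {t : Fin 3 → ℝ} (h : t ∈ cellB1.set false) : t ∉ cellB2.set false := fun h' => by
  rw [mem_cellB1] at h
  rw [mem_cellB2] at h'
  simp only [rel, Bool.false_eq_true, ↓reduceIte] at h h'
  push_cast at h h'
  obtain ⟨⟨h1, h2⟩, ⟨h3, h4⟩, ⟨h5, h6⟩⟩ := h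
  obtain ⟨⟨g1, g2⟩, ⟨g3, g4⟩, ⟨g5, g6⟩⟩ := h'
  linarith

/-- **Cover**: `B_{xyz}` is contained in the union of its closed cells (the displayed iterated
integral for `I(F↾B_{xyz})`, p. 32–33). [cite: Polymath8b2014, Section 7.4] -/
theorem cover_pieceB {t : Fin 3 → ℝ} (h : t ∈ pieceB) : t ∈ cellB1.set true ∨ t ∈ cellB2.set true := by
  obtain ⟨⟨hb0, hb1, hb2, hb3⟩, ⟨he0, he1, he2⟩⟩ := h
  by_cases hs : t 2 ≤ 5/8
  · left
    rw [mem_cellB1]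
    simp only [rel, ↓reduceIte]
    push_cast
    refine ⟨⟨?_, ?_⟩, ⟨?_, ?_⟩, ⟨?_, ?_⟩⟩ <;> linarith
  · right
    rw [not_le] at hs
    rw [mem_cellB2]
    simp only [rel, ↓reduceIte]
    push_cast
    refine ⟨⟨?_, ?_⟩, ⟨?_, ?_⟩, ⟨?_, ?_⟩⟩ <;> linarith

/-- The open cell `cellC1` lies in `C_{xyz}`. [folklore] -/
theorem mem_pieceC_of_mem_cellC1 {t : Fin 3 → ℝ} (h : t ∈ cellC1.set false) : t ∈ pieceC := by
  rw [mem_cellC1] at h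
  simp only [rel, Bool.false_eq_true, ↓reduceIte] at h
  push_cast at h
  obtain ⟨⟨h1, h2⟩, ⟨h3, h4⟩, ⟨h5, h6⟩⟩ := h
  refine ⟨⟨?_, ?_, ?_, ?_⟩, ⟨?_, ?_, ?_⟩⟩ <;> linarith

/-- The open cell `cellC2` lies in `C_{xyz}`. [folklore] -/
theorem mem_pieceC_of_mem_cellC2 {t : Fin 3 → ℝ} (h : t ∈ cellC2.set false) : t ∈ pieceC := by
  rw [mem_cellC2] at h
  simp only [rel, Bool.false_eq_true, ↓reduceIte] at h
  push_cast at h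
  obtain ⟨⟨h1, h2⟩, ⟨h3, h4⟩, ⟨h5, h6⟩⟩ := h
  refine ⟨⟨?_, ?_, ?_, ?_⟩, ⟨?_, ?_, ?_⟩⟩ <;> linarith

/-- The open cell `cellC3` lies in `C_{xyz}`. [folklore] -/
theorem mem_pieceC_of_mem_cellC3 {t : Fin 3 → ℝ} (h : t ∈ cellC3.set false) : t ∈ pieceC := by
  rw [mem_cellC3] at h
  simp only [rel, Bool.false_eq_true, ↓reduceIte] at h
  push_cast at h
  obtain ⟨⟨h1, h2⟩, ⟨h3, h4⟩, ⟨h5, h6⟩⟩ := h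
  refine ⟨⟨?_, ?_, ?_, ?_⟩, ⟨?_, ?_, ?_⟩⟩ <;> linarith

/-- The open cells `cellC1`, `cellC2` are disjoint. [folklore] -/
theorem not_mem_cellC2_of_mem_cellC1 {t : Fin 3 → ℝ} (h : t ∈ cellC1.set false) : t ∉ cellC2.set false := fun h' => by
  rw [mem_cellC1] at h
  rw [mem_cellC2] at h'
  simp only [rel, Bool.false_eq_true, ↓reduceIte] at h h'
  push_cast at h h'
  obtain ⟨⟨h1, h2⟩, ⟨h3, h4⟩, ⟨h5, h6⟩⟩ := h
  obtain ⟨⟨g1, g2⟩, ⟨g3, g4⟩, ⟨g5, g6⟩⟩ := h'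
  linarith

/-- The open cells `cellC1`, `cellC3` are disjoint. [folklore] -/
theorem not_mem_cellC3_of_mem_cellC1 {t : Fin 3 → ℝ} (h : t ∈ cellC1.set false) : t ∉ cellC3.set false := fun h' => by
  rw [mem_cellC1] at h
  rw [mem_cellC3] at h'
  simp only [rel, Bool.false_eq_true, ↓reduceIte] at h h'
  push_cast at h h'
  obtain ⟨⟨h1, h2⟩, ⟨h3, h4⟩, ⟨h5, h6⟩⟩ := h
  obtain ⟨⟨g1, g2⟩, ⟨g3, g4⟩, ⟨g5, g6⟩⟩ := h'
  linarith

/-- The open cells `cellC2`, `cellC3` are disjoint. [folklore] -/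
theorem not_mem_cellC3_of_mem_cellC2 {t : Fin 3 → ℝ} (h : t ∈ cellC2.set false) : t ∉ cellC3.set false := fun h' => by
  rw [mem_cellC2] at h
  rw [mem_cellC3] at h'
  simp only [rel, Bool.false_eq_true, ↓reduceIte] at h h'
  push_cast at h h'
  obtain ⟨⟨h1, h2⟩, ⟨h3, h4⟩, ⟨h5, h6⟩⟩ := h
  obtain ⟨⟨g1, g2⟩, ⟨g3, g4⟩, ⟨g5, g6⟩⟩ := h'
  linarith

/-- **Cover**: `C_{xyz}` is contained in the union of its closed cells (the displayed iterated
integral for `I(F↾C_{xyz})`, p. 32–33). [cite: Polymath8b2014, Section 7.4] -/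
theorem cover_pieceC {t : Fin 3 → ℝ} (h : t ∈ pieceC) : t ∈ cellC1.set true ∨ t ∈ cellC2.set true ∨ t ∈ cellC3.set true := by
  obtain ⟨⟨hb0, hb1, hb2, hb3⟩, ⟨he0, he1, he2⟩⟩ := h
  by_cases hs : t 1 ≤ 1/8
  · left
    rw [mem_cellC1]
    simp only [rel, ↓reduceIte]
    push_cast
    refine ⟨⟨?_, ?_⟩, ⟨?_, ?_⟩, ⟨?_, ?_⟩⟩ <;> linarith
  · rw [not_le] at hs
    by_cases hs2 : t 1 ≤ 1/4
    · right; left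
      rw [mem_cellC2]
      simp only [rel, ↓reduceIte]
      push_cast
      refine ⟨⟨?_, ?_⟩, ⟨?_, ?_⟩, ⟨?_, ?_⟩⟩ <;> linarith
    · right; right
      rw [not_le] at hs2
      rw [mem_cellC3]
      simp only [rel, ↓reduceIte]
      push_cast
      refine ⟨⟨?_, ?_⟩, ⟨?_, ?_⟩, ⟨?_, ?_⟩⟩ <;> linarith

/-- The open cell `cellE` lies in `E_{xyz}`. [folklore] -/
theorem mem_pieceE_of_mem_cellE {t : Fin 3 → ℝ} (h : t ∈ cellE.set false) : t ∈ pieceE := by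
  rw [mem_cellE] at h
  simp only [rel, Bool.false_eq_true, ↓reduceIte] at h
  push_cast at h
  obtain ⟨⟨h1, h2⟩, ⟨h3, h4⟩, ⟨h5, h6⟩⟩ := h
  refine ⟨⟨?_, ?_, ?_, ?_⟩, ⟨?_, ?_⟩⟩ <;> linarith

/-- **Cover**: `E_{xyz}` is contained in the union of its closed cells (the displayed iterated
integral for `I(F↾E_{xyz})`, p. 32–33). [cite: Polymath8b2014, Section 7.4] -/
theorem cover_pieceE {t : Fin 3 → ℝ} (h : t ∈ pieceE) : t ∈ cellE.set true := by
  obtain ⟨⟨hb0, hb1, hb2, hb3⟩, ⟨he0, he1⟩⟩ := h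
  rw [mem_cellE]
  simp only [rel, ↓reduceIte]
  push_cast
  refine ⟨⟨?_, ?_⟩, ⟨?_, ?_⟩, ⟨?_, ?_⟩⟩ <;> linarith

/-- The open cell `cellS1` lies in `S_{xyz}`. [folklore] -/
theorem mem_pieceS_of_mem_cellS1 {t : Fin 3 → ℝ} (h : t ∈ cellS1.set false) : t ∈ pieceS := by
  rw [mem_cellS1] at h
  simp only [rel, Bool.false_eq_true, ↓reduceIte] at h
  push_cast at h
  obtain ⟨⟨h1, h2⟩, ⟨h3, h4⟩, ⟨h5, h6⟩⟩ := h
  refine ⟨⟨?_, ?_, ?_, ?_⟩, ⟨?_, ?_, ?_, ?_, ?_⟩⟩ <;> linarith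

/-- The open cell `cellS2` lies in `S_{xyz}`. [folklore] -/
theorem mem_pieceS_of_mem_cellS2 {t : Fin 3 → ℝ} (h : t ∈ cellS2.set false) : t ∈ pieceS := by
  rw [mem_cellS2] at h
  simp only [rel, Bool.false_eq_true, ↓reduceIte] at h
  push_cast at h
  obtain ⟨⟨h1, h2⟩, ⟨h3, h4⟩, ⟨h5, h6⟩⟩ := h
  refine ⟨⟨?_, ?_, ?_, ?_⟩, ⟨?_, ?_, ?_, ?_, ?_⟩⟩ <;> linarith

/-- The open cells `cellS1`, `cellS2` are disjoint. [folklore] -/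
theorem not_mem_cellS2_of_mem_cellS1 {t : Fin 3 → ℝ} (h : t ∈ cellS1.set false) : t ∉ cellS2.set false := fun h' => by
  rw [mem_cellS1] at h
  rw [mem_cellS2] at h'
  simp only [rel, Bool.false_eq_true, ↓reduceIte] at h h'
  push_cast at h h'
  obtain ⟨⟨h1, h2⟩, ⟨h3, h4⟩, ⟨h5, h6⟩⟩ := h
  obtain ⟨⟨g1, g2⟩, ⟨g3, g4⟩, ⟨g5, g6⟩⟩ := h'
  linarith

/-- **Cover**: `S_{xyz}` is contained in the union of its closed cells (the displayed iterated
integral for `I(F↾S_{xyz})`, p. 32–33). [cite: Polymath8b2014, Section 7.4] -/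
theorem cover_pieceS {t : Fin 3 → ℝ} (h : t ∈ pieceS) : t ∈ cellS1.set true ∨ t ∈ cellS2.set true := by
  obtain ⟨⟨hb0, hb1, hb2, hb3⟩, ⟨he0, he1, he2, he3, he4⟩⟩ := h
  by_cases hs : t 1 ≤ 1/8
  · left
    rw [mem_cellS1]
    simp only [rel, ↓reduceIte]
    push_cast
    refine ⟨⟨?_, ?_⟩, ⟨?_, ?_⟩, ⟨?_, ?_⟩⟩ <;> linarith
  · right
    rw [not_le] at hs
    rw [mem_cellS2]
    simp only [rel, ↓reduceIte]
    push_cast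
    refine ⟨⟨?_, ?_⟩, ⟨?_, ?_⟩, ⟨?_, ?_⟩⟩ <;> linarith

/-- The open cell `cellT1` lies in `T_{xyz}`. [folklore] -/
theorem mem_pieceT_of_mem_cellT1 {t : Fin 3 → ℝ} (h : t ∈ cellT1.set false) : t ∈ pieceT := by
  rw [mem_cellT1] at h
  simp only [rel, Bool.false_eq_true, ↓reduceIte] at h
  push_cast at h
  obtain ⟨⟨h1, h2⟩, ⟨h3, h4⟩, ⟨h5, h6⟩⟩ := h
  refine ⟨⟨?_, ?_, ?_, ?_⟩, ⟨?_, ?_, ?_, ?_, ?_, ?_⟩⟩ <;> linarith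

/-- The open cell `cellT2` lies in `T_{xyz}`. [folklore] -/
theorem mem_pieceT_of_mem_cellT2 {t : Fin 3 → ℝ} (h : t ∈ cellT2.set false) : t ∈ pieceT := by
  rw [mem_cellT2] at h
  simp only [rel, Bool.false_eq_true, ↓reduceIte] at h
  push_cast at h
  obtain ⟨⟨h1, h2⟩, ⟨h3, h4⟩, ⟨h5, h6⟩⟩ := h
  refine ⟨⟨?_, ?_, ?_, ?_⟩, ⟨?_, ?_, ?_, ?_, ?_, ?_⟩⟩ <;> linarith

/-- The open cells `cellT1`, `cellT2` are disjoint. [folklore] -/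
theorem not_mem_cellT2_of_mem_cellT1 {t : Fin 3 → ℝ} (h : t ∈ cellT1.set false) : t ∉ cellT2.set false := fun h' => by
  rw [mem_cellT1] at h
  rw [mem_cellT2] at h'
  simp only [rel, Bool.false_eq_true, ↓reduceIte] at h h'
  push_cast at h h'
  obtain ⟨⟨h1, h2⟩, ⟨h3, h4⟩, ⟨h5, h6⟩⟩ := h
  obtain ⟨⟨g1, g2⟩, ⟨g3, g4⟩, ⟨g5, g6⟩⟩ := h'
  linarith

/-- **Cover**: `T_{xyz}` is contained in the union of its closed cells (the displayed iterated
integral for `I(F↾T_{xyz})`, p. 32–33). [cite: Polymath8b2014, Section 7.4] -/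
theorem cover_pieceT {t : Fin 3 → ℝ} (h : t ∈ pieceT) : t ∈ cellT1.set true ∨ t ∈ cellT2.set true := by
  obtain ⟨⟨hb0, hb1, hb2, hb3⟩, ⟨he0, he1, he2, he3, he4, he5⟩⟩ := h
  by_cases hs : t 2 ≤ 1
  · left
    rw [mem_cellT1]
    simp only [rel, ↓reduceIte]
    push_cast
    refine ⟨⟨?_, ?_⟩, ⟨?_, ?_⟩, ⟨?_, ?_⟩⟩ <;> linarith
  · right
    rw [not_le] at hs
    rw [mem_cellT2]
    simp only [rel, ↓reduceIte]
    push_cast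
    refine ⟨⟨?_, ?_⟩, ⟨?_, ?_⟩, ⟨?_, ?_⟩⟩ <;> linarith

/-- The open cell `cellU` lies in `U_{xyz}`. [folklore] -/
theorem mem_pieceU_of_mem_cellU {t : Fin 3 → ℝ} (h : t ∈ cellU.set false) : t ∈ pieceU := by
  rw [mem_cellU] at h
  simp only [rel, Bool.false_eq_true, ↓reduceIte] at h
  push_cast at h
  obtain ⟨⟨h1, h2⟩, ⟨h3, h4⟩, ⟨h5, h6⟩⟩ := h
  refine ⟨⟨?_, ?_, ?_, ?_⟩, ⟨?_, ?_, ?_, ?_, ?_⟩⟩ <;> linarith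

/-- **Cover**: `U_{xyz}` is contained in the union of its closed cells (the displayed iterated
integral for `I(F↾U_{xyz})`, p. 32–33). [cite: Polymath8b2014, Section 7.4] -/
theorem cover_pieceU {t : Fin 3 → ℝ} (h : t ∈ pieceU) : t ∈ cellU.set true := by
  obtain ⟨⟨hb0, hb1, hb2, hb3⟩, ⟨he0, he1, he2, he3, he4⟩⟩ := h
  rw [mem_cellU]
  simp only [rel, ↓reduceIte]
  push_cast
  refine ⟨⟨?_, ?_⟩, ⟨?_, ?_⟩, ⟨?_, ?_⟩⟩ <;> linarith

/-- The open cell `cellG` lies in `G_{xyz}`. [folklore] -/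
theorem mem_pieceG_of_mem_cellG {t : Fin 3 → ℝ} (h : t ∈ cellG.set false) : t ∈ pieceG := by
  rw [mem_cellG] at h
  simp only [rel, Bool.false_eq_true, ↓reduceIte] at h
  push_cast at h
  obtain ⟨⟨h1, h2⟩, ⟨h3, h4⟩, ⟨h5, h6⟩⟩ := h
  refine ⟨⟨?_, ?_, ?_, ?_⟩, ⟨?_, ?_⟩⟩ <;> linarith

/-- **Cover**: `G_{xyz}` is contained in the union of its closed cells (the displayed iterated
integral for `I(F↾G_{xyz})`, p. 32–33). [cite: Polymath8b2014, Section 7.4] -/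
theorem cover_pieceG {t : Fin 3 → ℝ} (h : t ∈ pieceG) : t ∈ cellG.set true := by
  obtain ⟨⟨hb0, hb1, hb2, hb3⟩, ⟨he0, he1⟩⟩ := h
  rw [mem_cellG]
  simp only [rel, ↓reduceIte]
  push_cast
  refine ⟨⟨?_, ?_⟩, ⟨?_, ?_⟩, ⟨?_, ?_⟩⟩ <;> linarith

/-- The open cell `cellH1` lies in `H_{xyz}`. [folklore] -/
theorem mem_pieceH_of_mem_cellH1 {t : Fin 3 → ℝ} (h : t ∈ cellH1.set false) : t ∈ pieceH := by
  rw [mem_cellH1] at h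
  simp only [rel, Bool.false_eq_true, ↓reduceIte] at h
  push_cast at h
  obtain ⟨⟨h1, h2⟩, ⟨h3, h4⟩, ⟨h5, h6⟩⟩ := h
  refine ⟨⟨?_, ?_, ?_, ?_⟩, ⟨?_, ?_, ?_⟩⟩ <;> linarith

/-- The open cell `cellH2` lies in `H_{xyz}`. [folklore] -/
theorem mem_pieceH_of_mem_cellH2 {t : Fin 3 → ℝ} (h : t ∈ cellH2.set false) : t ∈ pieceH := by
  rw [mem_cellH2] at h
  simp only [rel, Bool.false_eq_true, ↓reduceIte] at h
  push_cast at h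
  obtain ⟨⟨h1, h2⟩, ⟨h3, h4⟩, ⟨h5, h6⟩⟩ := h
  refine ⟨⟨?_, ?_, ?_, ?_⟩, ⟨?_, ?_, ?_⟩⟩ <;> linarith

/-- The open cells `cellH1`, `cellH2` are disjoint. [folklore] -/
theorem not_mem_cellH2_of_mem_cellH1 {t : Fin 3 → ℝ} (h : t ∈ cellH1.set false) : t ∉ cellH2.set false := fun h' => by
  rw [mem_cellH1] at h
  rw [mem_cellH2] at h'
  simp only [rel, Bool.false_eq_true, ↓reduceIte] at h h'
  push_cast at h h'
  obtain ⟨⟨h1, h2⟩, ⟨h3, h4⟩, ⟨h5, h6⟩⟩ := h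
  obtain ⟨⟨g1, g2⟩, ⟨g3, g4⟩, ⟨g5, g6⟩⟩ := h'
  linarith

/-- **Cover**: `H_{xyz}` is contained in the union of its closed cells (the displayed iterated
integral for `I(F↾H_{xyz})`, p. 32–33). [cite: Polymath8b2014, Section 7.4] -/
theorem cover_pieceH {t : Fin 3 → ℝ} (h : t ∈ pieceH) : t ∈ cellH1.set true ∨ t ∈ cellH2.set true := by
  obtain ⟨⟨hb0, hb1, hb2, hb3⟩, ⟨he0, he1, he2⟩⟩ := h
  by_cases hs : 5/8 ≤ t 0
  · left
    rw [mem_cellH1]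
    simp only [rel, ↓reduceIte]
    push_cast
    refine ⟨⟨?_, ?_⟩, ⟨?_, ?_⟩, ⟨?_, ?_⟩⟩ <;> linarith
  · right
    rw [not_le] at hs
    rw [mem_cellH2]
    simp only [rel, ↓reduceIte]
    push_cast
    refine ⟨⟨?_, ?_⟩, ⟨?_, ?_⟩, ⟨?_, ?_⟩⟩ <;> linarith
/-! ### The integrals `∫ 1_P (F↾P)²` and `I(F)` -/

open MeasureTheory

/-- The box `[0, 3/2]³`. [folklore] -/
theorem mem_box_of_base {t : Fin 3 → ℝ} (h : 0 < t 1 ∧ t 1 < t 0 ∧ t 0 < t 2 ∧ t 0 + t 1 + t 2 < 3 / 2) :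
    t ∈ Set.pi Set.univ fun _ : Fin 3 => Set.Icc (0 : ℝ) (3 / 2) := by
  obtain ⟨h1, h2, h3, h4⟩ := h
  simp only [Set.mem_univ_pi, Set.mem_Icc]
  intro k
  fin_cases k
  · exact ⟨by simp; linarith, by simp; linarith⟩
  · exact ⟨by simp; linarith, by simp; linarith⟩
  · exact ⟨by simp; linarith, by simp; linarith⟩

/-- Indicators of pieces times continuous functions are integrable. [folklore] -/
theorem integrable_indicator_piece {S : Set (Fin 3 → ℝ)} (hS : MeasurableSet S)
    (hbox : S ⊆ Set.pi Set.univ fun _ : Fin 3 => Set.Icc (0 : ℝ) (3 / 2)) {f : (Fin 3 → ℝ) → ℝ}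
    (hf : Continuous f) : Integrable (S.indicator f) := by
  rw [integrable_indicator_iff hS]
  exact (hf.continuousOn.integrableOn_compact (isCompact_univ_pi fun _ => isCompact_Icc)).mono_set hbox

/-- Indicator of a cell applied to its (squared) integrand is nonnegative. [folklore] -/
theorem indicator_integrand_nonneg {c : GCell} {b : Bool} {q : Q3} {f : (Fin 3 → ℝ) → ℝ}
    (hq : ∀ t, c.integrand q t = f t ^ 2) (t : Fin 3 → ℝ) : 0 ≤ (c.set b).indicator (c.integrand q) t := by
  refine Set.indicator_nonneg (fun s _ => ?_) t
  rw [hq]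
  positivity


/-- Pointwise upper bound for `1_A (F↾A)²` by its closed cells. [folklore] -/
theorem upper_pieceA (t : Fin 3 → ℝ) :
    pieceA.indicator (fun t : Fin 3 → ℝ => polyA (t 0) (t 1) (t 2) ^ 2) t ≤ (cellA.set true).indicator (cellA.integrand (ops3.mul qA_xyz qA_xyz)) t := by
  have n_cellA := indicator_integrand_nonneg (b := true) integrand_cellA t
  by_cases ht : t ∈ pieceA
  · rw [Set.indicator_of_mem ht]
    have hc := cover_pieceA ht
    rw [Set.indicator_of_mem hc, integrand_cellA]
  · rw [Set.indicator_of_notMem ht]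
    linarith


/-- Pointwise lower bound for `1_A (F↾A)²` by its open cells. [folklore] -/
theorem lower_pieceA (t : Fin 3 → ℝ) :
    (cellA.set false).indicator (cellA.integrand (ops3.mul qA_xyz qA_xyz)) t ≤ pieceA.indicator (fun t : Fin 3 → ℝ => polyA (t 0) (t 1) (t 2) ^ 2) t := by
  have n_P : 0 ≤ pieceA.indicator (fun t : Fin 3 → ℝ => polyA (t 0) (t 1) (t 2) ^ 2) t := Set.indicator_nonneg (fun s _ => by positivity) t
  by_cases h0 : t ∈ cellA.set false
  · rw [Set.indicator_of_mem h0, integrand_cellA, Set.indicator_of_mem (mem_pieceA_of_mem_cellA h0)]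
  rw [Set.indicator_of_notMem h0]
  exact n_P


/-- **`∫ 1_{A_{xyz}} (F↾A)² = 510146607951/37580963840`** (the display `I(F↾A_{xyz})` of pp. 32–33, exactly).
[cite: Polymath8b2014, Section 7.4] -/
theorem integral_pieceA :
    ∫ t, pieceA.indicator (fun t : Fin 3 → ℝ => polyA (t 0) (t 1) (t 2) ^ 2) t = 510146607951 / 37580963840 := by
  obtain ⟨mA, mB, mC, mE, mS, mT, mU, mG, mH⟩ := measurableSet_pieces
  obtain ⟨cA, cB, cC, cE, cS, cT, cU, cG, cH⟩ := continuous_polys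
  have hP : Integrable (pieceA.indicator (fun t : Fin 3 → ℝ => polyA (t 0) (t 1) (t 2) ^ 2)) :=
    integrable_indicator_piece mA (fun t ht => mem_box_of_base ht.1) (cA.pow 2)
  have i_cellA_true : Integrable ((cellA.set true).indicator (cellA.integrand (ops3.mul qA_xyz qA_xyz))) := cellA.integrable_indicator true _
  have v_cellA_true : ∫ t, (cellA.set true).indicator (cellA.integrand (ops3.mul qA_xyz qA_xyz)) t = (510146607951 / 37580963840 : ℚ) := by
    rw [cellA.integral_indicator_eq cellA_wf, integral_cellA]
  have i_cellA_false : Integrable ((cellA.set false).indicator (cellA.integrand (ops3.mul qA_xyz qA_xyz))) := cellA.integrable_indicator false _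
  have v_cellA_false : ∫ t, (cellA.set false).indicator (cellA.integrand (ops3.mul qA_xyz qA_xyz)) t = (510146607951 / 37580963840 : ℚ) := by
    rw [cellA.integral_indicator_eq cellA_wf, integral_cellA]
  apply le_antisymm
  · have h := integral_mono (f := pieceA.indicator (fun t : Fin 3 → ℝ => polyA (t 0) (t 1) (t 2) ^ 2)) (g := fun t => (cellA.set true).indicator (cellA.integrand (ops3.mul qA_xyz qA_xyz)) t) hP i_cellA_true upper_pieceA
    rw [v_cellA_true] at h
    push_cast at h
    linarith
  · have h := integral_mono (f := fun t => (cellA.set false).indicator (cellA.integrand (ops3.mul qA_xyz qA_xyz)) t) (g := pieceA.indicator (fun t : Fin 3 → ℝ => polyA (t 0) (t 1) (t 2) ^ 2)) i_cellA_false hP lower_pieceA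
    rw [v_cellA_false] at h
    push_cast at h
    linarith


/-- Pointwise upper bound for `1_B (F↾B)²` by its closed cells. [folklore] -/
theorem upper_pieceB (t : Fin 3 → ℝ) :
    pieceB.indicator (fun t : Fin 3 → ℝ => polyB (t 0) (t 1) (t 2) ^ 2) t ≤ (cellB1.set true).indicator (cellB1.integrand (ops3.mul qB_zxy qB_zxy)) t + (cellB2.set true).indicator (cellB2.integrand (ops3.mul qB_zxy qB_zxy)) t := by
  have n_cellB1 := indicator_integrand_nonneg (b := true) integrand_cellB1 t
  have n_cellB2 := indicator_integrand_nonneg (b := true) integrand_cellB2 t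
  by_cases ht : t ∈ pieceB
  · rw [Set.indicator_of_mem ht]
    rcases cover_pieceB ht with hc | hc
    · rw [Set.indicator_of_mem hc, integrand_cellB1] at *
      linarith
    · rw [Set.indicator_of_mem hc, integrand_cellB2] at *
      linarith
  · rw [Set.indicator_of_notMem ht]
    linarith


/-- Pointwise lower bound for `1_B (F↾B)²` by its open cells. [folklore] -/
theorem lower_pieceB (t : Fin 3 → ℝ) :
    (cellB1.set false).indicator (cellB1.integrand (ops3.mul qB_zxy qB_zxy)) t + (cellB2.set false).indicator (cellB2.integrand (ops3.mul qB_zxy qB_zxy)) t ≤ pieceB.indicator (fun t : Fin 3 → ℝ => polyB (t 0) (t 1) (t 2) ^ 2) t := by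
  have n_P : 0 ≤ pieceB.indicator (fun t : Fin 3 → ℝ => polyB (t 0) (t 1) (t 2) ^ 2) t := Set.indicator_nonneg (fun s _ => by positivity) t
  by_cases h0 : t ∈ cellB1.set false
  · rw [Set.indicator_of_mem h0, integrand_cellB1, Set.indicator_of_mem (mem_pieceB_of_mem_cellB1 h0), Set.indicator_of_notMem (not_mem_cellB2_of_mem_cellB1 h0)]
    linarith
  by_cases h1 : t ∈ cellB2.set false
  · rw [Set.indicator_of_mem h1, integrand_cellB2, Set.indicator_of_mem (mem_pieceB_of_mem_cellB2 h1), Set.indicator_of_notMem h0]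
    linarith
  rw [Set.indicator_of_notMem h0, Set.indicator_of_notMem h1]
  linarith


/-- **`∫ 1_{B_{xyz}} (F↾B)² = 651228330271/190253629440`** (the display `I(F↾B_{xyz})` of pp. 32–33, exactly).
[cite: Polymath8b2014, Section 7.4] -/
theorem integral_pieceB :
    ∫ t, pieceB.indicator (fun t : Fin 3 → ℝ => polyB (t 0) (t 1) (t 2) ^ 2) t = 651228330271 / 190253629440 := by
  obtain ⟨mA, mB, mC, mE, mS, mT, mU, mG, mH⟩ := measurableSet_pieces
  obtain ⟨cA, cB, cC, cE, cS, cT, cU, cG, cH⟩ := continuous_polys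
  have hP : Integrable (pieceB.indicator (fun t : Fin 3 → ℝ => polyB (t 0) (t 1) (t 2) ^ 2)) :=
    integrable_indicator_piece mB (fun t ht => mem_box_of_base ht.1) (cB.pow 2)
  have i_cellB1_true : Integrable ((cellB1.set true).indicator (cellB1.integrand (ops3.mul qB_zxy qB_zxy))) := cellB1.integrable_indicator true _
  have v_cellB1_true : ∫ t, (cellB1.set true).indicator (cellB1.integrand (ops3.mul qB_zxy qB_zxy)) t = (45659974501 / 19025362944 : ℚ) := by
    rw [cellB1.integral_indicator_eq cellB1_wf, integral_cellB1]
  have i_cellB2_true : Integrable ((cellB2.set true).indicator (cellB2.integrand (ops3.mul qB_zxy qB_zxy))) := cellB2.integrable_indicator true _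
  have v_cellB2_true : ∫ t, (cellB2.set true).indicator (cellB2.integrand (ops3.mul qB_zxy qB_zxy)) t = (64876195087 / 63417876480 : ℚ) := by
    rw [cellB2.integral_indicator_eq cellB2_wf, integral_cellB2]
  have i_cellB1_false : Integrable ((cellB1.set false).indicator (cellB1.integrand (ops3.mul qB_zxy qB_zxy))) := cellB1.integrable_indicator false _
  have v_cellB1_false : ∫ t, (cellB1.set false).indicator (cellB1.integrand (ops3.mul qB_zxy qB_zxy)) t = (45659974501 / 19025362944 : ℚ) := by
    rw [cellB1.integral_indicator_eq cellB1_wf, integral_cellB1]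
  have i_cellB2_false : Integrable ((cellB2.set false).indicator (cellB2.integrand (ops3.mul qB_zxy qB_zxy))) := cellB2.integrable_indicator false _
  have v_cellB2_false : ∫ t, (cellB2.set false).indicator (cellB2.integrand (ops3.mul qB_zxy qB_zxy)) t = (64876195087 / 63417876480 : ℚ) := by
    rw [cellB2.integral_indicator_eq cellB2_wf, integral_cellB2]
  apply le_antisymm
  · have h := integral_mono (f := pieceB.indicator (fun t : Fin 3 → ℝ => polyB (t 0) (t 1) (t 2) ^ 2)) (g := fun t => (cellB1.set true).indicator (cellB1.integrand (ops3.mul qB_zxy qB_zxy)) t + (cellB2.set true).indicator (cellB2.integrand (ops3.mul qB_zxy qB_zxy)) t) hP (i_cellB1_true.add i_cellB2_true) upper_pieceB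
    rw [integral_add (f := fun t => (cellB1.set true).indicator (cellB1.integrand (ops3.mul qB_zxy qB_zxy)) t) i_cellB1_true i_cellB2_true, v_cellB1_true, v_cellB2_true] at h
    push_cast at h
    linarith
  · have h := integral_mono (f := fun t => (cellB1.set false).indicator (cellB1.integrand (ops3.mul qB_zxy qB_zxy)) t + (cellB2.set false).indicator (cellB2.integrand (ops3.mul qB_zxy qB_zxy)) t) (g := pieceB.indicator (fun t : Fin 3 → ℝ => polyB (t 0) (t 1) (t 2) ^ 2)) (i_cellB1_false.add i_cellB2_false) hP lower_pieceB
    rw [integral_add (f := fun t => (cellB1.set false).indicator (cellB1.integrand (ops3.mul qB_zxy qB_zxy)) t) i_cellB1_false i_cellB2_false, v_cellB1_false, v_cellB2_false] at h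
    push_cast at h
    linarith


/-- Pointwise upper bound for `1_C (F↾C)²` by its closed cells. [folklore] -/
theorem upper_pieceC (t : Fin 3 → ℝ) :
    pieceC.indicator (fun t : Fin 3 → ℝ => polyC (t 0) (t 1) (t 2) ^ 2) t ≤ (cellC1.set true).indicator (cellC1.integrand (ops3.mul qC_yxz qC_yxz)) t + (cellC2.set true).indicator (cellC2.integrand (ops3.mul qC_yxz qC_yxz)) t + (cellC3.set true).indicator (cellC3.integrand (ops3.mul qC_yxz qC_yxz)) t := by
  have n_cellC1 := indicator_integrand_nonneg (b := true) integrand_cellC1 t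
  have n_cellC2 := indicator_integrand_nonneg (b := true) integrand_cellC2 t
  have n_cellC3 := indicator_integrand_nonneg (b := true) integrand_cellC3 t
  by_cases ht : t ∈ pieceC
  · rw [Set.indicator_of_mem ht]
    rcases cover_pieceC ht with hc | hc | hc
    · rw [Set.indicator_of_mem hc, integrand_cellC1] at *
      linarith
    · rw [Set.indicator_of_mem hc, integrand_cellC2] at *
      linarith
    · rw [Set.indicator_of_mem hc, integrand_cellC3] at *
      linarith
  · rw [Set.indicator_of_notMem ht]
    linarith


/-- Pointwise lower bound for `1_C (F↾C)²` by its open cells. [folklore] -/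
theorem lower_pieceC (t : Fin 3 → ℝ) :
    (cellC1.set false).indicator (cellC1.integrand (ops3.mul qC_yxz qC_yxz)) t + (cellC2.set false).indicator (cellC2.integrand (ops3.mul qC_yxz qC_yxz)) t + (cellC3.set false).indicator (cellC3.integrand (ops3.mul qC_yxz qC_yxz)) t ≤ pieceC.indicator (fun t : Fin 3 → ℝ => polyC (t 0) (t 1) (t 2) ^ 2) t := by
  have n_P : 0 ≤ pieceC.indicator (fun t : Fin 3 → ℝ => polyC (t 0) (t 1) (t 2) ^ 2) t := Set.indicator_nonneg (fun s _ => by positivity) t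
  by_cases h0 : t ∈ cellC1.set false
  · rw [Set.indicator_of_mem h0, integrand_cellC1, Set.indicator_of_mem (mem_pieceC_of_mem_cellC1 h0), Set.indicator_of_notMem (not_mem_cellC2_of_mem_cellC1 h0), Set.indicator_of_notMem (not_mem_cellC3_of_mem_cellC1 h0)]
    linarith
  by_cases h1 : t ∈ cellC2.set false
  · rw [Set.indicator_of_mem h1, integrand_cellC2, Set.indicator_of_mem (mem_pieceC_of_mem_cellC2 h1), Set.indicator_of_notMem h0, Set.indicator_of_notMem (not_mem_cellC3_of_mem_cellC2 h1)]
    linarith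
  by_cases h2 : t ∈ cellC3.set false
  · rw [Set.indicator_of_mem h2, integrand_cellC3, Set.indicator_of_mem (mem_pieceC_of_mem_cellC3 h2), Set.indicator_of_notMem h0, Set.indicator_of_notMem h1]
    linarith
  rw [Set.indicator_of_notMem h0, Set.indicator_of_notMem h1, Set.indicator_of_notMem h2]
  linarith


/-- **`∫ 1_{C_{xyz}} (F↾C)² = 332520721423/101468602368`** (the display `I(F↾C_{xyz})` of pp. 32–33, exactly).
[cite: Polymath8b2014, Section 7.4] -/
theorem integral_pieceC :
    ∫ t, pieceC.indicator (fun t : Fin 3 → ℝ => polyC (t 0) (t 1) (t 2) ^ 2) t = 332520721423 / 101468602368 := by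
  obtain ⟨mA, mB, mC, mE, mS, mT, mU, mG, mH⟩ := measurableSet_pieces
  obtain ⟨cA, cB, cC, cE, cS, cT, cU, cG, cH⟩ := continuous_polys
  have hP : Integrable (pieceC.indicator (fun t : Fin 3 → ℝ => polyC (t 0) (t 1) (t 2) ^ 2)) :=
    integrable_indicator_piece mC (fun t ht => mem_box_of_base ht.1) (cC.pow 2)
  have i_cellC1_true : Integrable ((cellC1.set true).indicator (cellC1.integrand (ops3.mul qC_yxz qC_yxz))) := cellC1.integrable_indicator true _
  have v_cellC1_true : ∫ t, (cellC1.set true).indicator (cellC1.integrand (ops3.mul qC_yxz qC_yxz)) t = (1801805723 / 754974720 : ℚ) := by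
    rw [cellC1.integral_indicator_eq cellC1_wf, integral_cellC1]
  have i_cellC2_true : Integrable ((cellC2.set true).indicator (cellC2.integrand (ops3.mul qC_yxz qC_yxz))) := cellC2.integrable_indicator true _
  have v_cellC2_true : ∫ t, (cellC2.set true).indicator (cellC2.integrand (ops3.mul qC_yxz qC_yxz)) t = (188256097591 / 253671505920 : ℚ) := by
    rw [cellC2.integral_indicator_eq cellC2_wf, integral_cellC2]
  have i_cellC3_true : Integrable ((cellC3.set true).indicator (cellC3.integrand (ops3.mul qC_yxz qC_yxz))) := cellC3.integrable_indicator true _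
  have v_cellC3_true : ∫ t, (cellC3.set true).indicator (cellC3.integrand (ops3.mul qC_yxz qC_yxz)) t = (8364218453 / 56371445760 : ℚ) := by
    rw [cellC3.integral_indicator_eq cellC3_wf, integral_cellC3]
  have i_cellC1_false : Integrable ((cellC1.set false).indicator (cellC1.integrand (ops3.mul qC_yxz qC_yxz))) := cellC1.integrable_indicator false _
  have v_cellC1_false : ∫ t, (cellC1.set false).indicator (cellC1.integrand (ops3.mul qC_yxz qC_yxz)) t = (1801805723 / 754974720 : ℚ) := by
    rw [cellC1.integral_indicator_eq cellC1_wf, integral_cellC1]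
  have i_cellC2_false : Integrable ((cellC2.set false).indicator (cellC2.integrand (ops3.mul qC_yxz qC_yxz))) := cellC2.integrable_indicator false _
  have v_cellC2_false : ∫ t, (cellC2.set false).indicator (cellC2.integrand (ops3.mul qC_yxz qC_yxz)) t = (188256097591 / 253671505920 : ℚ) := by
    rw [cellC2.integral_indicator_eq cellC2_wf, integral_cellC2]
  have i_cellC3_false : Integrable ((cellC3.set false).indicator (cellC3.integrand (ops3.mul qC_yxz qC_yxz))) := cellC3.integrable_indicator false _
  have v_cellC3_false : ∫ t, (cellC3.set false).indicator (cellC3.integrand (ops3.mul qC_yxz qC_yxz)) t = (8364218453 / 56371445760 : ℚ) := by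
    rw [cellC3.integral_indicator_eq cellC3_wf, integral_cellC3]
  apply le_antisymm
  · have h := integral_mono (f := pieceC.indicator (fun t : Fin 3 → ℝ => polyC (t 0) (t 1) (t 2) ^ 2)) (g := fun t => (cellC1.set true).indicator (cellC1.integrand (ops3.mul qC_yxz qC_yxz)) t + (cellC2.set true).indicator (cellC2.integrand (ops3.mul qC_yxz qC_yxz)) t + (cellC3.set true).indicator (cellC3.integrand (ops3.mul qC_yxz qC_yxz)) t) hP ((i_cellC1_true.add i_cellC2_true).add i_cellC3_true) upper_pieceC
    rw [integral_add (f := fun t => (cellC1.set true).indicator (cellC1.integrand (ops3.mul qC_yxz qC_yxz)) t + (cellC2.set true).indicator (cellC2.integrand (ops3.mul qC_yxz qC_yxz)) t) (i_cellC1_true.add i_cellC2_true) i_cellC3_true, integral_add (f := fun t => (cellC1.set true).indicator (cellC1.integrand (ops3.mul qC_yxz qC_yxz)) t) i_cellC1_true i_cellC2_true, v_cellC1_true, v_cellC2_true, v_cellC3_true] at h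
    push_cast at h
    linarith
  · have h := integral_mono (f := fun t => (cellC1.set false).indicator (cellC1.integrand (ops3.mul qC_yxz qC_yxz)) t + (cellC2.set false).indicator (cellC2.integrand (ops3.mul qC_yxz qC_yxz)) t + (cellC3.set false).indicator (cellC3.integrand (ops3.mul qC_yxz qC_yxz)) t) (g := pieceC.indicator (fun t : Fin 3 → ℝ => polyC (t 0) (t 1) (t 2) ^ 2)) ((i_cellC1_false.add i_cellC2_false).add i_cellC3_false) hP lower_pieceC
    rw [integral_add (f := fun t => (cellC1.set false).indicator (cellC1.integrand (ops3.mul qC_yxz qC_yxz)) t + (cellC2.set false).indicator (cellC2.integrand (ops3.mul qC_yxz qC_yxz)) t) (i_cellC1_false.add i_cellC2_false) i_cellC3_false, integral_add (f := fun t => (cellC1.set false).indicator (cellC1.integrand (ops3.mul qC_yxz qC_yxz)) t) i_cellC1_false i_cellC2_false, v_cellC1_false, v_cellC2_false, v_cellC3_false] at h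
    push_cast at h
    linarith


/-- Pointwise upper bound for `1_E (F↾E)²` by its closed cells. [folklore] -/
theorem upper_pieceE (t : Fin 3 → ℝ) :
    pieceE.indicator (fun t : Fin 3 → ℝ => polyE (t 0) (t 1) (t 2) ^ 2) t ≤ (cellE.set true).indicator (cellE.integrand (ops3.mul qE_zxy qE_zxy)) t := by
  have n_cellE := indicator_integrand_nonneg (b := true) integrand_cellE t
  by_cases ht : t ∈ pieceE
  · rw [Set.indicator_of_mem ht]
    have hc := cover_pieceE ht
    rw [Set.indicator_of_mem hc, integrand_cellE]
  · rw [Set.indicator_of_notMem ht]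
    linarith


/-- Pointwise lower bound for `1_E (F↾E)²` by its open cells. [folklore] -/
theorem lower_pieceE (t : Fin 3 → ℝ) :
    (cellE.set false).indicator (cellE.integrand (ops3.mul qE_zxy qE_zxy)) t ≤ pieceE.indicator (fun t : Fin 3 → ℝ => polyE (t 0) (t 1) (t 2) ^ 2) t := by
  have n_P : 0 ≤ pieceE.indicator (fun t : Fin 3 → ℝ => polyE (t 0) (t 1) (t 2) ^ 2) t := Set.indicator_nonneg (fun s _ => by positivity) t
  by_cases h0 : t ∈ cellE.set false
  · rw [Set.indicator_of_mem h0, integrand_cellE, Set.indicator_of_mem (mem_pieceE_of_mem_cellE h0)]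
  rw [Set.indicator_of_notMem h0]
  exact n_P


/-- **`∫ 1_{E_{xyz}} (F↾E)² = 367/15360`** (the display `I(F↾E_{xyz})` of pp. 32–33, exactly).
[cite: Polymath8b2014, Section 7.4] -/
theorem integral_pieceE :
    ∫ t, pieceE.indicator (fun t : Fin 3 → ℝ => polyE (t 0) (t 1) (t 2) ^ 2) t = 367 / 15360 := by
  obtain ⟨mA, mB, mC, mE, mS, mT, mU, mG, mH⟩ := measurableSet_pieces
  obtain ⟨cA, cB, cC, cE, cS, cT, cU, cG, cH⟩ := continuous_polys
  have hP : Integrable (pieceE.indicator (fun t : Fin 3 → ℝ => polyE (t 0) (t 1) (t 2) ^ 2)) :=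
    integrable_indicator_piece mE (fun t ht => mem_box_of_base ht.1) (cE.pow 2)
  have i_cellE_true : Integrable ((cellE.set true).indicator (cellE.integrand (ops3.mul qE_zxy qE_zxy))) := cellE.integrable_indicator true _
  have v_cellE_true : ∫ t, (cellE.set true).indicator (cellE.integrand (ops3.mul qE_zxy qE_zxy)) t = (367 / 15360 : ℚ) := by
    rw [cellE.integral_indicator_eq cellE_wf, integral_cellE]
  have i_cellE_false : Integrable ((cellE.set false).indicator (cellE.integrand (ops3.mul qE_zxy qE_zxy))) := cellE.integrable_indicator false _
  have v_cellE_false : ∫ t, (cellE.set false).indicator (cellE.integrand (ops3.mul qE_zxy qE_zxy)) t = (367 / 15360 : ℚ) := by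
    rw [cellE.integral_indicator_eq cellE_wf, integral_cellE]
  apply le_antisymm
  · have h := integral_mono (f := pieceE.indicator (fun t : Fin 3 → ℝ => polyE (t 0) (t 1) (t 2) ^ 2)) (g := fun t => (cellE.set true).indicator (cellE.integrand (ops3.mul qE_zxy qE_zxy)) t) hP i_cellE_true upper_pieceE
    rw [v_cellE_true] at h
    push_cast at h
    linarith
  · have h := integral_mono (f := fun t => (cellE.set false).indicator (cellE.integrand (ops3.mul qE_zxy qE_zxy)) t) (g := pieceE.indicator (fun t : Fin 3 → ℝ => polyE (t 0) (t 1) (t 2) ^ 2)) i_cellE_false hP lower_pieceE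
    rw [v_cellE_false] at h
    push_cast at h
    linarith


/-- Pointwise upper bound for `1_S (F↾S)²` by its closed cells. [folklore] -/
theorem upper_pieceS (t : Fin 3 → ℝ) :
    pieceS.indicator (fun t : Fin 3 → ℝ => polyS (t 0) (t 1) (t 2) ^ 2) t ≤ (cellS1.set true).indicator (cellS1.integrand (ops3.mul qS_yzx qS_yzx)) t + (cellS2.set true).indicator (cellS2.integrand (ops3.mul qS_yzx qS_yzx)) t := by
  have n_cellS1 := indicator_integrand_nonneg (b := true) integrand_cellS1 t
  have n_cellS2 := indicator_integrand_nonneg (b := true) integrand_cellS2 t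
  by_cases ht : t ∈ pieceS
  · rw [Set.indicator_of_mem ht]
    rcases cover_pieceS ht with hc | hc
    · rw [Set.indicator_of_mem hc, integrand_cellS1] at *
      linarith
    · rw [Set.indicator_of_mem hc, integrand_cellS2] at *
      linarith
  · rw [Set.indicator_of_notMem ht]
    linarith


/-- Pointwise lower bound for `1_S (F↾S)²` by its open cells. [folklore] -/
theorem lower_pieceS (t : Fin 3 → ℝ) :
    (cellS1.set false).indicator (cellS1.integrand (ops3.mul qS_yzx qS_yzx)) t + (cellS2.set false).indicator (cellS2.integrand (ops3.mul qS_yzx qS_yzx)) t ≤ pieceS.indicator (fun t : Fin 3 → ℝ => polyS (t 0) (t 1) (t 2) ^ 2) t := by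
  have n_P : 0 ≤ pieceS.indicator (fun t : Fin 3 → ℝ => polyS (t 0) (t 1) (t 2) ^ 2) t := Set.indicator_nonneg (fun s _ => by positivity) t
  by_cases h0 : t ∈ cellS1.set false
  · rw [Set.indicator_of_mem h0, integrand_cellS1, Set.indicator_of_mem (mem_pieceS_of_mem_cellS1 h0), Set.indicator_of_notMem (not_mem_cellS2_of_mem_cellS1 h0)]
    linarith
  by_cases h1 : t ∈ cellS2.set false
  · rw [Set.indicator_of_mem h1, integrand_cellS2, Set.indicator_of_mem (mem_pieceS_of_mem_cellS2 h1), Set.indicator_of_notMem h0]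
    linarith
  rw [Set.indicator_of_notMem h0, Set.indicator_of_notMem h1]
  linarith


/-- **`∫ 1_{S_{xyz}} (F↾S)² = 1/1536`** (the display `I(F↾S_{xyz})` of pp. 32–33, exactly).
[cite: Polymath8b2014, Section 7.4] -/
theorem integral_pieceS :
    ∫ t, pieceS.indicator (fun t : Fin 3 → ℝ => polyS (t 0) (t 1) (t 2) ^ 2) t = 1 / 1536 := by
  obtain ⟨mA, mB, mC, mE, mS, mT, mU, mG, mH⟩ := measurableSet_pieces
  obtain ⟨cA, cB, cC, cE, cS, cT, cU, cG, cH⟩ := continuous_polys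
  have hP : Integrable (pieceS.indicator (fun t : Fin 3 → ℝ => polyS (t 0) (t 1) (t 2) ^ 2)) :=
    integrable_indicator_piece mS (fun t ht => mem_box_of_base ht.1) (cS.pow 2)
  have i_cellS1_true : Integrable ((cellS1.set true).indicator (cellS1.integrand (ops3.mul qS_yzx qS_yzx))) := cellS1.integrable_indicator true _
  have v_cellS1_true : ∫ t, (cellS1.set true).indicator (cellS1.integrand (ops3.mul qS_yzx qS_yzx)) t = (3 / 10240 : ℚ) := by
    rw [cellS1.integral_indicator_eq cellS1_wf, integral_cellS1]
  have i_cellS2_true : Integrable ((cellS2.set true).indicator (cellS2.integrand (ops3.mul qS_yzx qS_yzx))) := cellS2.integrable_indicator true _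
  have v_cellS2_true : ∫ t, (cellS2.set true).indicator (cellS2.integrand (ops3.mul qS_yzx qS_yzx)) t = (11 / 30720 : ℚ) := by
    rw [cellS2.integral_indicator_eq cellS2_wf, integral_cellS2]
  have i_cellS1_false : Integrable ((cellS1.set false).indicator (cellS1.integrand (ops3.mul qS_yzx qS_yzx))) := cellS1.integrable_indicator false _
  have v_cellS1_false : ∫ t, (cellS1.set false).indicator (cellS1.integrand (ops3.mul qS_yzx qS_yzx)) t = (3 / 10240 : ℚ) := by
    rw [cellS1.integral_indicator_eq cellS1_wf, integral_cellS1]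
  have i_cellS2_false : Integrable ((cellS2.set false).indicator (cellS2.integrand (ops3.mul qS_yzx qS_yzx))) := cellS2.integrable_indicator false _
  have v_cellS2_false : ∫ t, (cellS2.set false).indicator (cellS2.integrand (ops3.mul qS_yzx qS_yzx)) t = (11 / 30720 : ℚ) := by
    rw [cellS2.integral_indicator_eq cellS2_wf, integral_cellS2]
  apply le_antisymm
  · have h := integral_mono (f := pieceS.indicator (fun t : Fin 3 → ℝ => polyS (t 0) (t 1) (t 2) ^ 2)) (g := fun t => (cellS1.set true).indicator (cellS1.integrand (ops3.mul qS_yzx qS_yzx)) t + (cellS2.set true).indicator (cellS2.integrand (ops3.mul qS_yzx qS_yzx)) t) hP (i_cellS1_true.add i_cellS2_true) upper_pieceS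
    rw [integral_add (f := fun t => (cellS1.set true).indicator (cellS1.integrand (ops3.mul qS_yzx qS_yzx)) t) i_cellS1_true i_cellS2_true, v_cellS1_true, v_cellS2_true] at h
    push_cast at h
    linarith
  · have h := integral_mono (f := fun t => (cellS1.set false).indicator (cellS1.integrand (ops3.mul qS_yzx qS_yzx)) t + (cellS2.set false).indicator (cellS2.integrand (ops3.mul qS_yzx qS_yzx)) t) (g := pieceS.indicator (fun t : Fin 3 → ℝ => polyS (t 0) (t 1) (t 2) ^ 2)) (i_cellS1_false.add i_cellS2_false) hP lower_pieceS
    rw [integral_add (f := fun t => (cellS1.set false).indicator (cellS1.integrand (ops3.mul qS_yzx qS_yzx)) t) i_cellS1_false i_cellS2_false, v_cellS1_false, v_cellS2_false] at h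
    push_cast at h
    linarith


/-- Pointwise upper bound for `1_T (F↾T)²` by its closed cells. [folklore] -/
theorem upper_pieceT (t : Fin 3 → ℝ) :
    pieceT.indicator (fun t : Fin 3 → ℝ => polyT (t 0) (t 1) (t 2) ^ 2) t ≤ (cellT1.set true).indicator (cellT1.integrand (ops3.mul qT_zxy qT_zxy)) t + (cellT2.set true).indicator (cellT2.integrand (ops3.mul qT_zxy qT_zxy)) t := by
  have n_cellT1 := indicator_integrand_nonneg (b := true) integrand_cellT1 t
  have n_cellT2 := indicator_integrand_nonneg (b := true) integrand_cellT2 t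
  by_cases ht : t ∈ pieceT
  · rw [Set.indicator_of_mem ht]
    rcases cover_pieceT ht with hc | hc
    · rw [Set.indicator_of_mem hc, integrand_cellT1] at *
      linarith
    · rw [Set.indicator_of_mem hc, integrand_cellT2] at *
      linarith
  · rw [Set.indicator_of_notMem ht]
    linarith


/-- Pointwise lower bound for `1_T (F↾T)²` by its open cells. [folklore] -/
theorem lower_pieceT (t : Fin 3 → ℝ) :
    (cellT1.set false).indicator (cellT1.integrand (ops3.mul qT_zxy qT_zxy)) t + (cellT2.set false).indicator (cellT2.integrand (ops3.mul qT_zxy qT_zxy)) t ≤ pieceT.indicator (fun t : Fin 3 → ℝ => polyT (t 0) (t 1) (t 2) ^ 2) t := by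
  have n_P : 0 ≤ pieceT.indicator (fun t : Fin 3 → ℝ => polyT (t 0) (t 1) (t 2) ^ 2) t := Set.indicator_nonneg (fun s _ => by positivity) t
  by_cases h0 : t ∈ cellT1.set false
  · rw [Set.indicator_of_mem h0, integrand_cellT1, Set.indicator_of_mem (mem_pieceT_of_mem_cellT1 h0), Set.indicator_of_notMem (not_mem_cellT2_of_mem_cellT1 h0)]
    linarith
  by_cases h1 : t ∈ cellT2.set false
  · rw [Set.indicator_of_mem h1, integrand_cellT2, Set.indicator_of_mem (mem_pieceT_of_mem_cellT2 h1), Set.indicator_of_notMem h0]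
    linarith
  rw [Set.indicator_of_notMem h0, Set.indicator_of_notMem h1]
  linarith


/-- **`∫ 1_{T_{xyz}} (F↾T)² = 14687/1290240`** (the display `I(F↾T_{xyz})` of pp. 32–33, exactly).
[cite: Polymath8b2014, Section 7.4] -/
theorem integral_pieceT :
    ∫ t, pieceT.indicator (fun t : Fin 3 → ℝ => polyT (t 0) (t 1) (t 2) ^ 2) t = 14687 / 1290240 := by
  obtain ⟨mA, mB, mC, mE, mS, mT, mU, mG, mH⟩ := measurableSet_pieces
  obtain ⟨cA, cB, cC, cE, cS, cT, cU, cG, cH⟩ := continuous_polys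
  have hP : Integrable (pieceT.indicator (fun t : Fin 3 → ℝ => polyT (t 0) (t 1) (t 2) ^ 2)) :=
    integrable_indicator_piece mT (fun t ht => mem_box_of_base ht.1) (cT.pow 2)
  have i_cellT1_true : Integrable ((cellT1.set true).indicator (cellT1.integrand (ops3.mul qT_zxy qT_zxy))) := cellT1.integrable_indicator true _
  have v_cellT1_true : ∫ t, (cellT1.set true).indicator (cellT1.integrand (ops3.mul qT_zxy qT_zxy)) t = (2149 / 245760 : ℚ) := by
    rw [cellT1.integral_indicator_eq cellT1_wf, integral_cellT1]
  have i_cellT2_true : Integrable ((cellT2.set true).indicator (cellT2.integrand (ops3.mul qT_zxy qT_zxy))) := cellT2.integrable_indicator true _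
  have v_cellT2_true : ∫ t, (cellT2.set true).indicator (cellT2.integrand (ops3.mul qT_zxy qT_zxy)) t = (13619 / 5160960 : ℚ) := by
    rw [cellT2.integral_indicator_eq cellT2_wf, integral_cellT2]
  have i_cellT1_false : Integrable ((cellT1.set false).indicator (cellT1.integrand (ops3.mul qT_zxy qT_zxy))) := cellT1.integrable_indicator false _
  have v_cellT1_false : ∫ t, (cellT1.set false).indicator (cellT1.integrand (ops3.mul qT_zxy qT_zxy)) t = (2149 / 245760 : ℚ) := by
    rw [cellT1.integral_indicator_eq cellT1_wf, integral_cellT1]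
  have i_cellT2_false : Integrable ((cellT2.set false).indicator (cellT2.integrand (ops3.mul qT_zxy qT_zxy))) := cellT2.integrable_indicator false _
  have v_cellT2_false : ∫ t, (cellT2.set false).indicator (cellT2.integrand (ops3.mul qT_zxy qT_zxy)) t = (13619 / 5160960 : ℚ) := by
    rw [cellT2.integral_indicator_eq cellT2_wf, integral_cellT2]
  apply le_antisymm
  · have h := integral_mono (f := pieceT.indicator (fun t : Fin 3 → ℝ => polyT (t 0) (t 1) (t 2) ^ 2)) (g := fun t => (cellT1.set true).indicator (cellT1.integrand (ops3.mul qT_zxy qT_zxy)) t + (cellT2.set true).indicator (cellT2.integrand (ops3.mul qT_zxy qT_zxy)) t) hP (i_cellT1_true.add i_cellT2_true) upper_pieceT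
    rw [integral_add (f := fun t => (cellT1.set true).indicator (cellT1.integrand (ops3.mul qT_zxy qT_zxy)) t) i_cellT1_true i_cellT2_true, v_cellT1_true, v_cellT2_true] at h
    push_cast at h
    linarith
  · have h := integral_mono (f := fun t => (cellT1.set false).indicator (cellT1.integrand (ops3.mul qT_zxy qT_zxy)) t + (cellT2.set false).indicator (cellT2.integrand (ops3.mul qT_zxy qT_zxy)) t) (g := pieceT.indicator (fun t : Fin 3 → ℝ => polyT (t 0) (t 1) (t 2) ^ 2)) (i_cellT1_false.add i_cellT2_false) hP lower_pieceT
    rw [integral_add (f := fun t => (cellT1.set false).indicator (cellT1.integrand (ops3.mul qT_zxy qT_zxy)) t) i_cellT1_false i_cellT2_false, v_cellT1_false, v_cellT2_false] at h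
    push_cast at h
    linarith


/-- Pointwise upper bound for `1_U (F↾U)²` by its closed cells. [folklore] -/
theorem upper_pieceU (t : Fin 3 → ℝ) :
    pieceU.indicator (fun t : Fin 3 → ℝ => polyU (t 0) (t 1) (t 2) ^ 2) t ≤ (cellU.set true).indicator (cellU.integrand (ops3.mul qU_xyz qU_xyz)) t := by
  have n_cellU := indicator_integrand_nonneg (b := true) integrand_cellU t
  by_cases ht : t ∈ pieceU
  · rw [Set.indicator_of_mem ht]
    have hc := cover_pieceU ht
    rw [Set.indicator_of_mem hc, integrand_cellU]
  · rw [Set.indicator_of_notMem ht]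
    linarith


/-- Pointwise lower bound for `1_U (F↾U)²` by its open cells. [folklore] -/
theorem lower_pieceU (t : Fin 3 → ℝ) :
    (cellU.set false).indicator (cellU.integrand (ops3.mul qU_xyz qU_xyz)) t ≤ pieceU.indicator (fun t : Fin 3 → ℝ => polyU (t 0) (t 1) (t 2) ^ 2) t := by
  have n_P : 0 ≤ pieceU.indicator (fun t : Fin 3 → ℝ => polyU (t 0) (t 1) (t 2) ^ 2) t := Set.indicator_nonneg (fun s _ => by positivity) t
  by_cases h0 : t ∈ cellU.set false
  · rw [Set.indicator_of_mem h0, integrand_cellU, Set.indicator_of_mem (mem_pieceU_of_mem_cellU h0)]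
  rw [Set.indicator_of_notMem h0]
  exact n_P


/-- **`∫ 1_{U_{xyz}} (F↾U)² = 8574409/247726080`** (the display `I(F↾U_{xyz})` of pp. 32–33, exactly).
[cite: Polymath8b2014, Section 7.4] -/
theorem integral_pieceU :
    ∫ t, pieceU.indicator (fun t : Fin 3 → ℝ => polyU (t 0) (t 1) (t 2) ^ 2) t = 8574409 / 247726080 := by
  obtain ⟨mA, mB, mC, mE, mS, mT, mU, mG, mH⟩ := measurableSet_pieces
  obtain ⟨cA, cB, cC, cE, cS, cT, cU, cG, cH⟩ := continuous_polys
  have hP : Integrable (pieceU.indicator (fun t : Fin 3 → ℝ => polyU (t 0) (t 1) (t 2) ^ 2)) :=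
    integrable_indicator_piece mU (fun t ht => mem_box_of_base ht.1) (cU.pow 2)
  have i_cellU_true : Integrable ((cellU.set true).indicator (cellU.integrand (ops3.mul qU_xyz qU_xyz))) := cellU.integrable_indicator true _
  have v_cellU_true : ∫ t, (cellU.set true).indicator (cellU.integrand (ops3.mul qU_xyz qU_xyz)) t = (8574409 / 247726080 : ℚ) := by
    rw [cellU.integral_indicator_eq cellU_wf, integral_cellU]
  have i_cellU_false : Integrable ((cellU.set false).indicator (cellU.integrand (ops3.mul qU_xyz qU_xyz))) := cellU.integrable_indicator false _
  have v_cellU_false : ∫ t, (cellU.set false).indicator (cellU.integrand (ops3.mul qU_xyz qU_xyz)) t = (8574409 / 247726080 : ℚ) := by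
    rw [cellU.integral_indicator_eq cellU_wf, integral_cellU]
  apply le_antisymm
  · have h := integral_mono (f := pieceU.indicator (fun t : Fin 3 → ℝ => polyU (t 0) (t 1) (t 2) ^ 2)) (g := fun t => (cellU.set true).indicator (cellU.integrand (ops3.mul qU_xyz qU_xyz)) t) hP i_cellU_true upper_pieceU
    rw [v_cellU_true] at h
    push_cast at h
    linarith
  · have h := integral_mono (f := fun t => (cellU.set false).indicator (cellU.integrand (ops3.mul qU_xyz qU_xyz)) t) (g := pieceU.indicator (fun t : Fin 3 → ℝ => polyU (t 0) (t 1) (t 2) ^ 2)) i_cellU_false hP lower_pieceU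
    rw [v_cellU_false] at h
    push_cast at h
    linarith


/-- Pointwise upper bound for `1_G (F↾G)²` by its closed cells. [folklore] -/
theorem upper_pieceG (t : Fin 3 → ℝ) :
    pieceG.indicator (fun t : Fin 3 → ℝ => polyG (t 0) (t 1) (t 2) ^ 2) t ≤ (cellG.set true).indicator (cellG.integrand (ops3.mul qG_xyz qG_xyz)) t := by
  have n_cellG := indicator_integrand_nonneg (b := true) integrand_cellG t
  by_cases ht : t ∈ pieceG
  · rw [Set.indicator_of_mem ht]
    have hc := cover_pieceG ht
    rw [Set.indicator_of_mem hc, integrand_cellG]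
  · rw [Set.indicator_of_notMem ht]
    linarith


/-- Pointwise lower bound for `1_G (F↾G)²` by its open cells. [folklore] -/
theorem lower_pieceG (t : Fin 3 → ℝ) :
    (cellG.set false).indicator (cellG.integrand (ops3.mul qG_xyz qG_xyz)) t ≤ pieceG.indicator (fun t : Fin 3 → ℝ => polyG (t 0) (t 1) (t 2) ^ 2) t := by
  have n_P : 0 ≤ pieceG.indicator (fun t : Fin 3 → ℝ => polyG (t 0) (t 1) (t 2) ^ 2) t := Set.indicator_nonneg (fun s _ => by positivity) t
  by_cases h0 : t ∈ cellG.set false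
  · rw [Set.indicator_of_mem h0, integrand_cellG, Set.indicator_of_mem (mem_pieceG_of_mem_cellG h0)]
  rw [Set.indicator_of_notMem h0]
  exact n_P


/-- **`∫ 1_{G_{xyz}} (F↾G)² = 4419599/148635648`** (the display `I(F↾G_{xyz})` of pp. 32–33, exactly).
[cite: Polymath8b2014, Section 7.4] -/
theorem integral_pieceG :
    ∫ t, pieceG.indicator (fun t : Fin 3 → ℝ => polyG (t 0) (t 1) (t 2) ^ 2) t = 4419599 / 148635648 := by
  obtain ⟨mA, mB, mC, mE, mS, mT, mU, mG, mH⟩ := measurableSet_pieces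
  obtain ⟨cA, cB, cC, cE, cS, cT, cU, cG, cH⟩ := continuous_polys
  have hP : Integrable (pieceG.indicator (fun t : Fin 3 → ℝ => polyG (t 0) (t 1) (t 2) ^ 2)) :=
    integrable_indicator_piece mG (fun t ht => mem_box_of_base ht.1) (cG.pow 2)
  have i_cellG_true : Integrable ((cellG.set true).indicator (cellG.integrand (ops3.mul qG_xyz qG_xyz))) := cellG.integrable_indicator true _
  have v_cellG_true : ∫ t, (cellG.set true).indicator (cellG.integrand (ops3.mul qG_xyz qG_xyz)) t = (4419599 / 148635648 : ℚ) := by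
    rw [cellG.integral_indicator_eq cellG_wf, integral_cellG]
  have i_cellG_false : Integrable ((cellG.set false).indicator (cellG.integrand (ops3.mul qG_xyz qG_xyz))) := cellG.integrable_indicator false _
  have v_cellG_false : ∫ t, (cellG.set false).indicator (cellG.integrand (ops3.mul qG_xyz qG_xyz)) t = (4419599 / 148635648 : ℚ) := by
    rw [cellG.integral_indicator_eq cellG_wf, integral_cellG]
  apply le_antisymm
  · have h := integral_mono (f := pieceG.indicator (fun t : Fin 3 → ℝ => polyG (t 0) (t 1) (t 2) ^ 2)) (g := fun t => (cellG.set true).indicator (cellG.integrand (ops3.mul qG_xyz qG_xyz)) t) hP i_cellG_true upper_pieceG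
    rw [v_cellG_true] at h
    push_cast at h
    linarith
  · have h := integral_mono (f := fun t => (cellG.set false).indicator (cellG.integrand (ops3.mul qG_xyz qG_xyz)) t) (g := pieceG.indicator (fun t : Fin 3 → ℝ => polyG (t 0) (t 1) (t 2) ^ 2)) i_cellG_false hP lower_pieceG
    rw [v_cellG_false] at h
    push_cast at h
    linarith


/-- Pointwise upper bound for `1_H (F↾H)²` by its closed cells. [folklore] -/
theorem upper_pieceH (t : Fin 3 → ℝ) :
    pieceH.indicator (fun t : Fin 3 → ℝ => polyH (t 0) (t 1) (t 2) ^ 2) t ≤ (cellH1.set true).indicator (cellH1.integrand (ops3.mul qH_xyz qH_xyz)) t + (cellH2.set true).indicator (cellH2.integrand (ops3.mul qH_xyz qH_xyz)) t := by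
  have n_cellH1 := indicator_integrand_nonneg (b := true) integrand_cellH1 t
  have n_cellH2 := indicator_integrand_nonneg (b := true) integrand_cellH2 t
  by_cases ht : t ∈ pieceH
  · rw [Set.indicator_of_mem ht]
    rcases cover_pieceH ht with hc | hc
    · rw [Set.indicator_of_mem hc, integrand_cellH1] at *
      linarith
    · rw [Set.indicator_of_mem hc, integrand_cellH2] at *
      linarith
  · rw [Set.indicator_of_notMem ht]
    linarith


/-- Pointwise lower bound for `1_H (F↾H)²` by its open cells. [folklore] -/
theorem lower_pieceH (t : Fin 3 → ℝ) :
    (cellH1.set false).indicator (cellH1.integrand (ops3.mul qH_xyz qH_xyz)) t + (cellH2.set false).indicator (cellH2.integrand (ops3.mul qH_xyz qH_xyz)) t ≤ pieceH.indicator (fun t : Fin 3 → ℝ => polyH (t 0) (t 1) (t 2) ^ 2) t := by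
  have n_P : 0 ≤ pieceH.indicator (fun t : Fin 3 → ℝ => polyH (t 0) (t 1) (t 2) ^ 2) t := Set.indicator_nonneg (fun s _ => by positivity) t
  by_cases h0 : t ∈ cellH1.set false
  · rw [Set.indicator_of_mem h0, integrand_cellH1, Set.indicator_of_mem (mem_pieceH_of_mem_cellH1 h0), Set.indicator_of_notMem (not_mem_cellH2_of_mem_cellH1 h0)]
    linarith
  by_cases h1 : t ∈ cellH2.set false
  · rw [Set.indicator_of_mem h1, integrand_cellH2, Set.indicator_of_mem (mem_pieceH_of_mem_cellH2 h1), Set.indicator_of_notMem h0]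
    linarith
  rw [Set.indicator_of_notMem h0, Set.indicator_of_notMem h1]
  linarith


/-- **`∫ 1_{H_{xyz}} (F↾H)² = 101/5120`** (the display `I(F↾H_{xyz})` of pp. 32–33, exactly).
[cite: Polymath8b2014, Section 7.4] -/
theorem integral_pieceH :
    ∫ t, pieceH.indicator (fun t : Fin 3 → ℝ => polyH (t 0) (t 1) (t 2) ^ 2) t = 101 / 5120 := by
  obtain ⟨mA, mB, mC, mE, mS, mT, mU, mG, mH⟩ := measurableSet_pieces
  obtain ⟨cA, cB, cC, cE, cS, cT, cU, cG, cH⟩ := continuous_polys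
  have hP : Integrable (pieceH.indicator (fun t : Fin 3 → ℝ => polyH (t 0) (t 1) (t 2) ^ 2)) :=
    integrable_indicator_piece mH (fun t ht => mem_box_of_base ht.1) (cH.pow 2)
  have i_cellH1_true : Integrable ((cellH1.set true).indicator (cellH1.integrand (ops3.mul qH_xyz qH_xyz))) := cellH1.integrable_indicator true _
  have v_cellH1_true : ∫ t, (cellH1.set true).indicator (cellH1.integrand (ops3.mul qH_xyz qH_xyz)) t = (101 / 10240 : ℚ) := by
    rw [cellH1.integral_indicator_eq cellH1_wf, integral_cellH1]
  have i_cellH2_true : Integrable ((cellH2.set true).indicator (cellH2.integrand (ops3.mul qH_xyz qH_xyz))) := cellH2.integrable_indicator true _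
  have v_cellH2_true : ∫ t, (cellH2.set true).indicator (cellH2.integrand (ops3.mul qH_xyz qH_xyz)) t = (101 / 10240 : ℚ) := by
    rw [cellH2.integral_indicator_eq cellH2_wf, integral_cellH2]
  have i_cellH1_false : Integrable ((cellH1.set false).indicator (cellH1.integrand (ops3.mul qH_xyz qH_xyz))) := cellH1.integrable_indicator false _
  have v_cellH1_false : ∫ t, (cellH1.set false).indicator (cellH1.integrand (ops3.mul qH_xyz qH_xyz)) t = (101 / 10240 : ℚ) := by
    rw [cellH1.integral_indicator_eq cellH1_wf, integral_cellH1]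
  have i_cellH2_false : Integrable ((cellH2.set false).indicator (cellH2.integrand (ops3.mul qH_xyz qH_xyz))) := cellH2.integrable_indicator false _
  have v_cellH2_false : ∫ t, (cellH2.set false).indicator (cellH2.integrand (ops3.mul qH_xyz qH_xyz)) t = (101 / 10240 : ℚ) := by
    rw [cellH2.integral_indicator_eq cellH2_wf, integral_cellH2]
  apply le_antisymm
  · have h := integral_mono (f := pieceH.indicator (fun t : Fin 3 → ℝ => polyH (t 0) (t 1) (t 2) ^ 2)) (g := fun t => (cellH1.set true).indicator (cellH1.integrand (ops3.mul qH_xyz qH_xyz)) t + (cellH2.set true).indicator (cellH2.integrand (ops3.mul qH_xyz qH_xyz)) t) hP (i_cellH1_true.add i_cellH2_true) upper_pieceH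
    rw [integral_add (f := fun t => (cellH1.set true).indicator (cellH1.integrand (ops3.mul qH_xyz qH_xyz)) t) i_cellH1_true i_cellH2_true, v_cellH1_true, v_cellH2_true] at h
    push_cast at h
    linarith
  · have h := integral_mono (f := fun t => (cellH1.set false).indicator (cellH1.integrand (ops3.mul qH_xyz qH_xyz)) t + (cellH2.set false).indicator (cellH2.integrand (ops3.mul qH_xyz qH_xyz)) t) (g := pieceH.indicator (fun t : Fin 3 → ℝ => polyH (t 0) (t 1) (t 2) ^ 2)) (i_cellH1_false.add i_cellH2_false) hP lower_pieceH
    rw [integral_add (f := fun t => (cellH1.set false).indicator (cellH1.integrand (ops3.mul qH_xyz qH_xyz)) t) i_cellH1_false i_cellH2_false, v_cellH1_false, v_cellH2_false] at h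
    push_cast at h
    linarith


/-- Integrability of each term of `Gsq`. [folklore] -/
theorem integrable_Gsq_terms :
    Integrable (pieceA.indicator fun t : Fin 3 → ℝ => polyA (t 0) (t 1) (t 2) ^ 2) ∧
    Integrable (pieceB.indicator fun t : Fin 3 → ℝ => polyB (t 0) (t 1) (t 2) ^ 2) ∧
    Integrable (pieceC.indicator fun t : Fin 3 → ℝ => polyC (t 0) (t 1) (t 2) ^ 2) ∧
    Integrable (pieceE.indicator fun t : Fin 3 → ℝ => polyE (t 0) (t 1) (t 2) ^ 2) ∧
    Integrable (pieceS.indicator fun t : Fin 3 → ℝ => polyS (t 0) (t 1) (t 2) ^ 2) ∧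
    Integrable (pieceT.indicator fun t : Fin 3 → ℝ => polyT (t 0) (t 1) (t 2) ^ 2) ∧
    Integrable (pieceU.indicator fun t : Fin 3 → ℝ => polyU (t 0) (t 1) (t 2) ^ 2) ∧
    Integrable (pieceG.indicator fun t : Fin 3 → ℝ => polyG (t 0) (t 1) (t 2) ^ 2) ∧
    Integrable (pieceH.indicator fun t : Fin 3 → ℝ => polyH (t 0) (t 1) (t 2) ^ 2) := by
  obtain ⟨mA, mB, mC, mE, mS, mT, mU, mG, mH⟩ := measurableSet_pieces
  obtain ⟨cA, cB, cC, cE, cS, cT, cU, cG, cH⟩ := continuous_polys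
  exact ⟨integrable_indicator_piece mA (fun t ht => mem_box_of_base ht.1) (cA.pow 2),
    integrable_indicator_piece mB (fun t ht => mem_box_of_base ht.1) (cB.pow 2),
    integrable_indicator_piece mC (fun t ht => mem_box_of_base ht.1) (cC.pow 2),
    integrable_indicator_piece mE (fun t ht => mem_box_of_base ht.1) (cE.pow 2),
    integrable_indicator_piece mS (fun t ht => mem_box_of_base ht.1) (cS.pow 2),
    integrable_indicator_piece mT (fun t ht => mem_box_of_base ht.1) (cT.pow 2),
    integrable_indicator_piece mU (fun t ht => mem_box_of_base ht.1) (cU.pow 2),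
    integrable_indicator_piece mG (fun t ht => mem_box_of_base ht.1) (cG.pow 2),
    integrable_indicator_piece mH (fun t ht => mem_box_of_base ht.1) (cH.pow 2)⟩

/-- **`∫ Gsq = I(F↾R_{xyz}) = 62082439864241/3044058071040`** (so that `I(F) = 6 · I(F↾R_{xyz})`, p. 32). [cite: Polymath8b2014, Section 7.4] -/
theorem integral_Gsq : ∫ t, Gsq t = 62082439864241 / 3044058071040 := by
  obtain ⟨iA, iB, iC, iE, iS, iT, iU, iG, iH⟩ := integrable_Gsq_terms
  unfold Gsq
  rw [integral_add (f := fun t => pieceA.indicator (fun t : Fin 3 → ℝ => polyA (t 0) (t 1) (t 2) ^ 2) t + pieceB.indicator (fun t : Fin 3 → ℝ => polyB (t 0) (t 1) (t 2) ^ 2) t + pieceC.indicator (fun t : Fin 3 → ℝ => polyC (t 0) (t 1) (t 2) ^ 2) t + pieceE.indicator (fun t : Fin 3 → ℝ => polyE (t 0) (t 1) (t 2) ^ 2) t + pieceS.indicator (fun t : Fin 3 → ℝ => polyS (t 0) (t 1) (t 2) ^ 2) t + pieceT.indicator (fun t : Fin 3 → ℝ => polyT (t 0) (t 1) (t 2)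 ^ 2) t + pieceU.indicator (fun t : Fin 3 → ℝ => polyU (t 0) (t 1) (t 2) ^ 2) t + pieceG.indicator (fun t : Fin 3 → ℝ => polyG (t 0) (t 1) (t 2) ^ 2) t) (((((((iA.add iB).add iC).add iE).add iS).add iT).add iU).add iG) iH,
    integral_add (f := fun t => pieceA.indicator (fun t : Fin 3 → ℝ => polyA (t 0) (t 1) (t 2) ^ 2) t + pieceB.indicator (fun t : Fin 3 → ℝ => polyB (t 0) (t 1) (t 2) ^ 2) t + pieceC.indicator (fun t : Fin 3 → ℝ => polyC (t 0) (t 1) (t 2) ^ 2) t + pieceE.indicator (fun t : Fin 3 → ℝ => polyE (t 0) (t 1) (t 2) ^ 2) t + pieceS.indicator (fun t : Fin 3 → ℝ => polyS (t 0) (t 1) (t 2) ^ 2) t + pieceT.indicator (fun t : Fin 3 → ℝ => polyT (t 0) (t 1) (t 2) ^ 2) t + pieceU.indicator (fun t : Fin 3 → ℝ => polyU (t 0) (t 1) (t 2) ^ 2) t) ((((((iA.add iB).add iC).add iE).add iS).add iT).add iU) iG,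
    integral_add (f := fun t => pieceA.indicator (fun t : Fin 3 → ℝ => polyA (t 0) (t 1) (t 2) ^ 2) t + pieceB.indicator (fun t : Fin 3 → ℝ => polyB (t 0) (t 1) (t 2) ^ 2) t + pieceC.indicator (fun t : Fin 3 → ℝ => polyC (t 0) (t 1) (t 2) ^ 2) t + pieceE.indicator (fun t : Fin 3 → ℝ => polyE (t 0) (t 1) (t 2) ^ 2) t + pieceS.indicator (fun t : Fin 3 → ℝ => polyS (t 0) (t 1) (t 2) ^ 2) t + pieceT.indicator (fun t : Fin 3 → ℝ => polyT (t 0) (t 1) (t 2) ^ 2) t) (((((iA.add iB).add iC).add iE).add iS).add iT) iU,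
    integral_add (f := fun t => pieceA.indicator (fun t : Fin 3 → ℝ => polyA (t 0) (t 1) (t 2) ^ 2) t + pieceB.indicator (fun t : Fin 3 → ℝ => polyB (t 0) (t 1) (t 2) ^ 2) t + pieceC.indicator (fun t : Fin 3 → ℝ => polyC (t 0) (t 1) (t 2) ^ 2) t + pieceE.indicator (fun t : Fin 3 → ℝ => polyE (t 0) (t 1) (t 2) ^ 2) t + pieceS.indicator (fun t : Fin 3 → ℝ => polyS (t 0) (t 1) (t 2) ^ 2) t) ((((iA.add iB).add iC).add iE).add iS) iT,
    integral_add (f := fun t => pieceA.indicator (fun t : Fin 3 → ℝ => polyA (t 0) (t 1) (t 2) ^ 2) t + pieceB.indicator (fun t : Fin 3 → ℝ => polyB (t 0) (t 1) (t 2) ^ 2) t + pieceC.indicator (fun t : Fin 3 → ℝ => polyC (t 0) (t 1) (t 2) ^ 2) t + pieceE.indicator (fun t : Fin 3 → ℝ => polyE (t 0) (t 1) (t 2) ^ 2) t) (((iA.add iB).add iC).add iE) iS,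
    integral_add (f := fun t => pieceA.indicator (fun t : Fin 3 → ℝ => polyA (t 0) (t 1) (t 2) ^ 2) t + pieceB.indicator (fun t : Fin 3 → ℝ => polyB (t 0) (t 1) (t 2) ^ 2) t + pieceC.indicator (fun t : Fin 3 → ℝ => polyC (t 0) (t 1) (t 2) ^ 2) t) ((iA.add iB).add iC) iE,
    integral_add (f := fun t => pieceA.indicator (fun t : Fin 3 → ℝ => polyA (t 0) (t 1) (t 2) ^ 2) t + pieceB.indicator (fun t : Fin 3 → ℝ => polyB (t 0) (t 1) (t 2) ^ 2) t) (iA.add iB) iC,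
    integral_add (f := fun t => pieceA.indicator (fun t : Fin 3 → ℝ => polyA (t 0) (t 1) (t 2) ^ 2) t) iA iB,
    integral_pieceA, integral_pieceB, integral_pieceC, integral_pieceE, integral_pieceS, integral_pieceT,
    integral_pieceU, integral_pieceG, integral_pieceH]
  norm_num

/-! ### `I(F) = 6 · I(F↾R_{xyz})` -/

/-- `Gsq` composed with a rearrangement of the coordinates is integrable. [folklore] -/
theorem integrable_Gsq_rearr (a b c : Fin 3) (hcov : ∀ k : Fin 3, k = a ∨ k = b ∨ k = c) :
    Integrable fun t : Fin 3 → ℝ => Gsq ![t a, t b, t c] := by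
  obtain ⟨C, hC⟩ := exists_bound_Gfun
  have hfun : (fun t : Fin 3 → ℝ => Gsq ![t a, t b, t c]) = fun t => Gfun ![t a, t b, t c] ^ 2 :=
    funext fun t => (Gfun_sq _).symm
  have hm : Measurable fun t : Fin 3 → ℝ => Gsq ![t a, t b, t c] := by
    rw [hfun]
    exact (measurable_Gfun.comp (measurable_rearr a b c)).pow_const 2
  refine integrable_of_bounded_box hm (C := C ^ 2) (fun t => ?_) (fun t ht => ?_)
  · rw [← Gfun_sq, abs_pow]
    exact pow_le_pow_left₀ (abs_nonneg _) (hC _) 2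
  · rw [← Gfun_sq]
    have h0 : Gfun ![t a, t b, t c] = 0 := by
      by_contra hne
      have hb := mem_box_of_Gfun_ne_zero hne
      apply ht
      simp only [Set.mem_univ_pi] at hb ⊢
      intro k
      rcases hcov k with rfl | rfl | rfl
      · simpa using hb 0
      · simpa using hb 1
      · simpa using hb 2
    rw [h0]
    ring

/-- **Polymath 8b, §7.4: `I(F) = 62082439864241/507343011840`** for the cutoff `F = F3` of
Theorem 3.15 ("One may compute that `I(F) = 62082439864241/507343011840`", p. 34), as an exact identity
for the tree's `polymathI`; by symmetry `I(F) = 3! · I(F↾R_{xyz})` (p. 32) and `I(F↾R_{xyz})` is the sum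
of the nine displayed iterated integrals, each evaluated exactly by the kernel. [cite: Polymath8b2014, Section 7.4] -/
theorem polymathI_F3 : polymathI 3 F3 = 62082439864241 / 507343011840 := by
  have h1 : polymathI 3 F3 = ∫ t, F3 t ^ 2 := by
    unfold polymathI
    apply setIntegral_eq_integral_of_forall_compl_eq_zero
    intro t ht
    have h0 : F3 t = 0 := by
      by_contra hne
      obtain ⟨⟨p0, p1, p2⟩, -⟩ := pos_of_F3_ne_zero hne
      apply ht
      intro i
      fin_cases i
      · exact p0.le
      · exact p1.le
      · exact p2.le
    rw [h0]
    ring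
  rw [h1]
  simp_rw [F3_sq]
  have hcov : ∀ k : Fin 3, k = 0 ∨ k = 1 ∨ k = 2 := by decide
  have i012 := integrable_Gsq_rearr 0 1 2 fun k => hcov k
  have i102 := integrable_Gsq_rearr 1 0 2 fun k => by rcases hcov k with h | h | h <;> simp [h]
  have i021 := integrable_Gsq_rearr 0 2 1 fun k => by rcases hcov k with h | h | h <;> simp [h]
  have i210 := integrable_Gsq_rearr 2 1 0 fun k => by rcases hcov k with h | h | h <;> simp [h]
  have i120 := integrable_Gsq_rearr 1 2 0 fun k => by rcases hcov k with h | h | h <;> simp [h]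
  have i201 := integrable_Gsq_rearr 2 0 1 fun k => by rcases hcov k with h | h | h <;> simp [h]
  have j1 : Integrable (fun t : Fin 3 → ℝ => Gsq ![t 0, t 1, t 2]) := i012
  have s2 : (∫ t : Fin 3 → ℝ, (Gsq ![t 0, t 1, t 2] + Gsq ![t 1, t 0, t 2])) = (∫ t : Fin 3 → ℝ, (Gsq ![t 0, t 1, t 2])) + ∫ t : Fin 3 → ℝ, Gsq ![t 1, t 0, t 2] :=
    integral_add j1 i102
  have j2 : Integrable (fun t : Fin 3 → ℝ => Gsq ![t 0, t 1, t 2] + Gsq ![t 1, t 0, t 2]) := j1.add i102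
  have s3 : (∫ t : Fin 3 → ℝ, (Gsq ![t 0, t 1, t 2] + Gsq ![t 1, t 0, t 2] + Gsq ![t 0, t 2, t 1])) = (∫ t : Fin 3 → ℝ, (Gsq ![t 0, t 1, t 2] + Gsq ![t 1, t 0, t 2])) + ∫ t : Fin 3 → ℝ, Gsq ![t 0, t 2, t 1] :=
    integral_add j2 i021
  have j3 : Integrable (fun t : Fin 3 → ℝ => Gsq ![t 0, t 1, t 2] + Gsq ![t 1, t 0, t 2] + Gsq ![t 0, t 2, t 1]) := j2.add i021
  have s4 : (∫ t : Fin 3 → ℝ, (Gsq ![t 0, t 1, t 2] + Gsq ![t 1, t 0, t 2] + Gsq ![t 0, t 2, t 1] + Gsq ![t 2, t 1, t 0])) = (∫ t : Fin 3 → ℝ, (Gsq ![t 0, t 1, t 2] + Gsq ![t 1, t 0, t 2] + Gsq ![t 0, t 2, t 1])) + ∫ t : Fin 3 → ℝ, Gsq ![t 2, t 1, t 0] :=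
    integral_add j3 i210
  have j4 : Integrable (fun t : Fin 3 → ℝ => Gsq ![t 0, t 1, t 2] + Gsq ![t 1, t 0, t 2] + Gsq ![t 0, t 2, t 1] + Gsq ![t 2, t 1, t 0]) := j3.add i210
  have s5 : (∫ t : Fin 3 → ℝ, (Gsq ![t 0, t 1, t 2] + Gsq ![t 1, t 0, t 2] + Gsq ![t 0, t 2, t 1] + Gsq ![t 2, t 1, t 0] + Gsq ![t 1, t 2, t 0])) = (∫ t : Fin 3 → ℝ, (Gsq ![t 0, t 1, t 2] + Gsq ![t 1, t 0, t 2] + Gsq ![t 0, t 2, t 1] + Gsq ![t 2, t 1, t 0])) + ∫ t : Fin 3 → ℝ, Gsq ![t 1, t 2, t 0] :=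
    integral_add j4 i120
  have j5 : Integrable (fun t : Fin 3 → ℝ => Gsq ![t 0, t 1, t 2] + Gsq ![t 1, t 0, t 2] + Gsq ![t 0, t 2, t 1] + Gsq ![t 2, t 1, t 0] + Gsq ![t 1, t 2, t 0]) := j4.add i120
  have s6 : (∫ t : Fin 3 → ℝ, (Gsq ![t 0, t 1, t 2] + Gsq ![t 1, t 0, t 2] + Gsq ![t 0, t 2, t 1] + Gsq ![t 2, t 1, t 0] + Gsq ![t 1, t 2, t 0] + Gsq ![t 2, t 0, t 1])) = (∫ t : Fin 3 → ℝ, (Gsq ![t 0, t 1, t 2] + Gsq ![t 1, t 0, t 2] + Gsq ![t 0, t 2, t 1] + Gsq ![t 2, t 1, t 0] + Gsq ![t 1, t 2, t 0])) + ∫ t : Fin 3 → ℝ, Gsq ![t 2, t 0, t 1] :=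
    integral_add j5 i201
  -- each of the six integrals equals `∫ Gsq`
  have e012 : ∫ t : Fin 3 → ℝ, Gsq ![t 0, t 1, t 2] = ∫ t, Gsq t := by
    have heta : ∀ t : Fin 3 → ℝ, ![t 0, t 1, t 2] = t := fun t => by
      funext k; fin_cases k <;> rfl
    simp_rw [heta]
  have e102 : ∫ t : Fin 3 → ℝ, Gsq ![t 1, t 0, t 2] = ∫ t, Gsq t := by
    have key := integral_comp_perm (Equiv.swap 0 1) Gsq
    have hfun : (fun t : Fin 3 → ℝ => Gsq fun k => t ((Equiv.swap 0 1) k)) = fun t => Gsq ![t 1, t 0, t 2] :=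
      funext fun t => by rw [rearr_102]
    rw [hfun] at key
    exact key
  have e021 : ∫ t : Fin 3 → ℝ, Gsq ![t 0, t 2, t 1] = ∫ t, Gsq t := by
    have key := integral_comp_perm (Equiv.swap 1 2) Gsq
    have hfun : (fun t : Fin 3 → ℝ => Gsq fun k => t ((Equiv.swap 1 2) k)) = fun t => Gsq ![t 0, t 2, t 1] :=
      funext fun t => by rw [rearr_021]
    rw [hfun] at key
    exact key
  have e210 : ∫ t : Fin 3 → ℝ, Gsq ![t 2, t 1, t 0] = ∫ t, Gsq t := by
    have key := integral_comp_perm (Equiv.swap 0 2) Gsq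
    have hfun : (fun t : Fin 3 → ℝ => Gsq fun k => t ((Equiv.swap 0 2) k)) = fun t => Gsq ![t 2, t 1, t 0] :=
      funext fun t => by rw [rearr_210]
    rw [hfun] at key
    exact key
  have e120 : ∫ t : Fin 3 → ℝ, Gsq ![t 1, t 2, t 0] = ∫ t, Gsq t := by
    have key := integral_comp_perm ((Equiv.swap (1 : Fin 3) 2).trans (Equiv.swap (0 : Fin 3) 1)) Gsq
    have hfun : (fun t : Fin 3 → ℝ => Gsq fun k => t (((Equiv.swap (1 : Fin 3) 2).trans (Equiv.swap (0 : Fin 3) 1)) k)) = fun t => Gsq ![t 1, t 2, t 0] :=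
      funext fun t => by rw [rearr_120]
    rw [hfun] at key
    exact key
  have e201 : ∫ t : Fin 3 → ℝ, Gsq ![t 2, t 0, t 1] = ∫ t, Gsq t := by
    have key := integral_comp_perm ((Equiv.swap (0 : Fin 3) 1).trans (Equiv.swap (1 : Fin 3) 2)) Gsq
    have hfun : (fun t : Fin 3 → ℝ => Gsq fun k => t (((Equiv.swap (0 : Fin 3) 1).trans (Equiv.swap (1 : Fin 3) 2)) k)) = fun t => Gsq ![t 2, t 0, t 1] :=
      funext fun t => by rw [rearr_201]
    rw [hfun] at key
    exact key
  rw [s6, s5, s4, s3, s2, e012, e102, e021, e210, e120, e201, integral_Gsq]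
  norm_num

/-- In particular `I(F) > 0`: `F3` is not almost everywhere zero. [cite: Polymath8b2014, Theorem 3.15] -/
theorem polymathI_F3_pos : 0 < polymathI 3 F3 := by
  rw [polymathI_F3]
  norm_num

end GEHCutoff

end Literature.NumberTheory.Sieve
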